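import Literature.Computability.MetaComplexity.EFModAddAssocMain
import HarnessLib

/-!
# Modular addition in extended Frege: associativity, II — the quotients

Layer D/4c of the `EF`-proof construction kit. For one side of the associativity law — an
"outer" occurrence `oA` (selector `G_A`, masks `N_A = G_A ∧ n`) and an "inner" occurrence `oB`
(selector `G_B`, result `res`, split adder `P_B = zext(res) + zext(G_B ∧ n)`), combined by the
`(W+2)`-bit adder `V = extOut P_B + zext N_A` of `EFModAddAssocMain.lean` — this file derives inside
Frege the *quotient lines*

  `[V ≥ n] ↔ (G_A ∨ G_B)` and `[V ≥ 2n] ↔ (G_A ∧ G_B)`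

(`ModAdd.AssocQuot.quot`), from the certificate `res < n` and the global certificate `0 < n`, by
a case analysis on `G_A` and `G_B` using the order laws of `EFOrder.lean` (monotonicity in both
directions, `x + z ≥ z`, transitivity) on the auxiliary template `ModAdd.quotAuxT` (the adder
`n + n`, comparators of `V` with `n` and `2n`, and the adders/comparators the order laws require).
With both sides and the identity of `EFModAddAssocMain.lean`, the rule `rQuot` yields
`G₁ + G₂ = G₃ + G₄`, consumed by the cancellation of `EFModAddAssoc.lean`.

## Sources

* S. A. Cook, R. A. Reckhow, *The relative efficiency of propositional proof systems*,
  J. Symbolic Logic 44 (1979), §2 (sound schematic rules).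
* J. Krajíček, *Bounded Arithmetic, Propositional Logic, and Complexity Theory* (CUP 1995), §9.2.
-/

namespace Literature.Computability.MetaComplexity

open _root_.Computability Complexity Complexity.PropForm FregeSystem Netlist

namespace ModAdd

/-! ### The auxiliary template

Inputs (`6W + 8`): `n` (`0…W-1`), `res` (`W…2W-1`), the masks of `oA` (`2W…3W-1`), the `⊥` gate of
`oA` (`3W`), the masks of `oB` (`3W+1…4W`), the `⊥` gate of `oB` (`4W+1`), the fixed `⊥` gate `fz`
(`4W+2`), the output word of `P_B` (`4W+3…5W+4`, `W+2` bits), the output word of `V`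
(`5W+5…6W+7`, `W+3` bits). -/

namespace AssocQuot

/-- `n` zero-extended by `fz`: input references, at any width. [folklore] -/
def wN (W i : ℕ) : ℕ ⊕ ℕ := if i < W then Sum.inl i else Sum.inl (4 * W + 2)

/-- `2n` zero-extended: the sum bits and carry of the adder `n + n` (at offset `0`), then `fz`.
[folklore] -/
def wN2 (W i : ℕ) : ℕ ⊕ ℕ := if i < W then Sum.inr (2 * i + 1) else if i = W then Sum.inr (2 * W) else Sum.inl (4 * W + 2)

/-- The masks `N_A` zero-extended: masks, the `⊥` gate of `oA`, then `fz`. [folklore] -/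
def wNA (W i : ℕ) : ℕ ⊕ ℕ := if i < W then Sum.inl (2 * W + i) else if i = W then Sum.inl (3 * W) else Sum.inl (4 * W + 2)

/-- The masks `N_B` zero-extended: masks, the `⊥` gate of `oB`, then `fz`. [folklore] -/
def wNB (W i : ℕ) : ℕ ⊕ ℕ := if i < W then Sum.inl (3 * W + 1 + i) else if i = W then Sum.inl (4 * W + 1) else Sum.inl (4 * W + 2)

/-- Two-operand wiring from operand wirings. [folklore] -/
def wiring2 (w : ℕ) (x y : ℕ → ℕ ⊕ ℕ) (i : ℕ) : ℕ ⊕ ℕ := if i < w then x i else y (i - w)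

/-- The fifteen pieces of the quotient template. [cite: Vollmer1999, §1.2] -/
def pieces (W : ℕ) : ℕ → Piece
  | 0 => ⟨Adder.addT false W, 2 * W, wiring2 W (fun i => Sum.inl i) fun i => Sum.inl i⟩
  | 1 => ⟨Adder.addT false W, 2 * W, wiring2 W (fun _ => Sum.inl (4 * W + 2)) fun i => Sum.inl i⟩
  | 2 => ⟨Sub.subT W, 2 * W, wiring2 W (fun _ => Sum.inl (4 * W + 2)) fun i => Sum.inl i⟩
  | 3 => ⟨Sub.subT (W + 1), 2 * (W + 1), wiring2 (W + 1) (fun i => if i < W then Sum.inr (2 * W + 1 + (2 * i + 1)) else Sum.inr (2 * W + 1 + 2 * W))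
      fun i => if i < W then Sum.inr (2 * i + 1) else Sum.inr (2 * W)⟩
  | 4 => ⟨Sub.subT (W + 3), 2 * (W + 3), wiring2 (W + 3) (wN W) (wN2 W)⟩
  | 5 => ⟨Sub.subT (W + 3), 2 * (W + 3), wiring2 (W + 3) (fun i => Sum.inl (5 * W + 5 + i)) (wN W)⟩
  | 6 => ⟨Sub.subT (W + 3), 2 * (W + 3), wiring2 (W + 3) (fun i => Sum.inl (5 * W + 5 + i)) (wN2 W)⟩
  | 7 => ⟨Sub.subT (W + 3), 2 * (W + 3), wiring2 (W + 3) (fun i => Sum.inl (5 * W + 5 + i)) (wNA W)⟩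
  | 8 => ⟨Sub.subT (W + 2), 2 * (W + 2), wiring2 (W + 2) (fun i => Sum.inl (4 * W + 3 + i)) (wNB W)⟩
  | 9 => ⟨Sub.subT (W + 2), 2 * (W + 2), wiring2 (W + 2) (fun i => Sum.inl (4 * W + 3 + i)) (wN W)⟩
  | 10 => ⟨Adder.addT false (W + 2), 2 * (W + 2), wiring2 (W + 2) (wN W) (wNA W)⟩
  | 11 => ⟨Sub.subT (W + 3), 2 * (W + 3), wiring2 (W + 3) (fun i => Sum.inl (5 * W + 5 + i))
      fun i => if i < W + 2 then Sum.inr (28 * W + 61 + (2 * i + 1)) else Sum.inr (28 * W + 61 + 2 * (W + 2))⟩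
  | 12 => ⟨Sub.subT (W + 1), 2 * (W + 1), wiring2 (W + 1) (fun i => if i < W then Sum.inl (W + i) else Sum.inl (4 * W + 1)) (wN W)⟩
  | 13 => ⟨Adder.addT false (W + 1), 2 * (W + 1), wiring2 (W + 1) (wN W) (wNB W)⟩
  | _ => ⟨Sub.subT (W + 2), 2 * (W + 2), wiring2 (W + 2) (fun i => Sum.inl (4 * W + 3 + i))
      fun i => if i < W + 1 then Sum.inr (36 * W + 80 + (2 * i + 1)) else Sum.inr (36 * W + 80 + 2 * (W + 1))⟩

end AssocQuot

/-- **The auxiliary template of the quotient lines.** [cite: Vollmer1999, §1.2] -/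
def quotAuxT (W : ℕ) : Template := layout (AssocQuot.pieces W) 15

namespace AssocQuot

/-- The offsets of the fifteen pieces. [folklore] -/
theorem offsets (W : ℕ) :
    offset (pieces W) 1 = 2 * W + 1 ∧ offset (pieces W) 2 = 4 * W + 2 ∧ offset (pieces W) 3 = 7 * W + 3 ∧
    offset (pieces W) 4 = 10 * W + 7 ∧ offset (pieces W) 5 = 13 * W + 17 ∧ offset (pieces W) 6 = 16 * W + 27 ∧
    offset (pieces W) 7 = 19 * W + 37 ∧ offset (pieces W) 8 = 22 * W + 47 ∧ offset (pieces W) 9 = 25 * W + 54 ∧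
    offset (pieces W) 10 = 28 * W + 61 ∧ offset (pieces W) 11 = 30 * W + 66 ∧ offset (pieces W) 12 = 33 * W + 76 ∧
    offset (pieces W) 13 = 36 * W + 80 ∧ offset (pieces W) 14 = 38 * W + 83 ∧ offset (pieces W) 15 = 41 * W + 90 := by
  have h1 : offset (pieces W) 1 = 2 * W + 1 := by rw [offset_succ, offset_zero]; simp [pieces]
  have h2 : offset (pieces W) 2 = 4 * W + 2 := by rw [offset_succ, h1]; simp [pieces]; ring
  have h3 : offset (pieces W) 3 = 7 * W + 3 := by rw [offset_succ, h2]; simp [pieces]; ring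
  have h4 : offset (pieces W) 4 = 10 * W + 7 := by rw [offset_succ, h3]; simp [pieces]; ring
  have h5 : offset (pieces W) 5 = 13 * W + 17 := by rw [offset_succ, h4]; simp [pieces]; ring
  have h6 : offset (pieces W) 6 = 16 * W + 27 := by rw [offset_succ, h5]; simp [pieces]; ring
  have h7 : offset (pieces W) 7 = 19 * W + 37 := by rw [offset_succ, h6]; simp [pieces]; ring
  have h8 : offset (pieces W) 8 = 22 * W + 47 := by rw [offset_succ, h7]; simp [pieces]; ring
  have h9 : offset (pieces W) 9 = 25 * W + 54 := by rw [offset_succ, h8]; simp [pieces]; ring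
  have h10 : offset (pieces W) 10 = 28 * W + 61 := by rw [offset_succ, h9]; simp [pieces]; ring
  have h11 : offset (pieces W) 11 = 30 * W + 66 := by rw [offset_succ, h10]; simp [pieces]; ring
  have h12 : offset (pieces W) 12 = 33 * W + 76 := by rw [offset_succ, h11]; simp [pieces]; ring
  have h13 : offset (pieces W) 13 = 36 * W + 80 := by rw [offset_succ, h12]; simp [pieces]; ring
  have h14 : offset (pieces W) 14 = 38 * W + 83 := by rw [offset_succ, h13]; simp [pieces]; ring
  have h15 : offset (pieces W) 15 = 41 * W + 90 := by rw [offset_succ, h14]; simp [pieces]; ring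
  exact ⟨h1, h2, h3, h4, h5, h6, h7, h8, h9, h10, h11, h12, h13, h14, h15⟩

/-- A piece with two-operand wiring is well wired as soon as both operand wirings point to inputs
`< 6W+8` or gates below the offset. [folklore] -/
theorem ok_of (W : ℕ) {k : ℕ} {T : Template} {w : ℕ} {x y : ℕ → ℕ ⊕ ℕ} (hP : pieces W k = ⟨T, 2 * w, wiring2 w x y⟩) (hwf : T.WF (2 * w))
    (hx : ∀ i < w, (∀ a, x i = Sum.inl a → a < 6 * W + 8) ∧ (∀ g, x i = Sum.inr g → g < offset (pieces W) k))
    (hy : ∀ i < w, (∀ a, y i = Sum.inl a → a < 6 * W + 8) ∧ (∀ g, y i = Sum.inr g → g < offset (pieces W) k)) :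
    Piece.OK (pieces W) (6 * W + 8) k := by
  unfold Piece.OK; rw [hP]
  refine ⟨hwf, fun i hi => ?_⟩
  have hi' : i < 2 * w := hi
  show (∀ a, wiring2 w x y i = Sum.inl a → _) ∧ (∀ g, wiring2 w x y i = Sum.inr g → _)
  unfold wiring2
  split_ifs with h
  · exact hx i h
  · exact hy (i - w) (by omega)

/-- The operand wirings are well wired. [folklore] -/
theorem wN_ok (W i b : ℕ) : (∀ a, wN W i = Sum.inl a → a < 6 * W + 8) ∧ (∀ g, wN W i = Sum.inr g → g < b) := by
  unfold wN; split_ifs <;> exact ⟨fun a ha => by cases ha; omega, fun g hg => by cases hg⟩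

/-- The operand wirings are well wired. [folklore] -/
theorem wNA_ok (W i b : ℕ) : (∀ a, wNA W i = Sum.inl a → a < 6 * W + 8) ∧ (∀ g, wNA W i = Sum.inr g → g < b) := by
  unfold wNA; split_ifs <;> exact ⟨fun a ha => by cases ha; omega, fun g hg => by cases hg⟩

/-- The operand wirings are well wired. [folklore] -/
theorem wNB_ok (W i b : ℕ) : (∀ a, wNB W i = Sum.inl a → a < 6 * W + 8) ∧ (∀ g, wNB W i = Sum.inr g → g < b) := by
  unfold wNB; split_ifs <;> exact ⟨fun a ha => by cases ha; omega, fun g hg => by cases hg⟩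

/-- The operand wirings are well wired (`2n` reads the adder at offset `0`, below any positive offset
`≥ 2W+1`). [folklore] -/
theorem wN2_ok (W i : ℕ) {b : ℕ} (hb : 2 * W + 1 ≤ b) :
    (∀ a, wN2 W i = Sum.inl a → a < 6 * W + 8) ∧ (∀ g, wN2 W i = Sum.inr g → g < b) := by
  unfold wN2; split_ifs <;> first
    | exact ⟨fun a ha => (by cases ha), fun g hg => by cases hg; omega⟩
    | exact ⟨fun a ha => by cases ha; omega, fun g hg => by cases hg⟩

/-- Every piece is well formed and well wired. [cite: Vollmer1999, Def. 1.6] -/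
theorem piece_ok (W : ℕ) : ∀ k < 15, Piece.OK (pieces W) (6 * W + 8) k := by
  obtain ⟨h1, h2, h3, h4, h5, h6, h7, h8, h9, h10, h11, h12, h13, h14, -⟩ := offsets W
  intro k hk
  have hk' : k = 0 ∨ k = 1 ∨ k = 2 ∨ k = 3 ∨ k = 4 ∨ k = 5 ∨ k = 6 ∨ k = 7 ∨ k = 8 ∨ k = 9 ∨ k = 10 ∨ k = 11 ∨ k = 12 ∨ k = 13 ∨ k = 14 := by
    omega
  rcases hk' with rfl | rfl | rfl | rfl | rfl | rfl | rfl | rfl | rfl | rfl | rfl | rfl | rfl | rfl | rfl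
  · exact ok_of W rfl (Adder.wf_addT false W) (fun i hi => ⟨fun a ha => by cases ha; omega, fun g hg => by cases hg⟩)
      fun i hi => ⟨fun a ha => by cases ha; omega, fun g hg => by cases hg⟩
  · exact ok_of W rfl (Adder.wf_addT false W) (fun i hi => ⟨fun a ha => by cases ha; omega, fun g hg => by cases hg⟩)
      fun i hi => ⟨fun a ha => by cases ha; omega, fun g hg => by cases hg⟩
  · exact ok_of W rfl (Sub.wf_subT W) (fun i hi => ⟨fun a ha => by cases ha; omega, fun g hg => by cases hg⟩)
      fun i hi => ⟨fun a ha => by cases ha; omega, fun g hg => by cases hg⟩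
  · refine ok_of W (w := W + 1) rfl (Sub.wf_subT (W + 1)) (fun i hi => ?_) fun i hi => ?_ <;> rw [h3] <;> split_ifs <;>
      exact ⟨fun a ha => (by cases ha), fun g hg => by cases hg; omega⟩
  · exact ok_of W (w := W + 3) rfl (Sub.wf_subT (W + 3)) (fun i hi => wN_ok W i _) fun i hi => wN2_ok W i (by rw [h4]; omega)
  · exact ok_of W (w := W + 3) rfl (Sub.wf_subT (W + 3)) (fun i hi => ⟨fun a ha => by cases ha; omega, fun g hg => by cases hg⟩)
      fun i hi => wN_ok W i _
  · exact ok_of W (w := W + 3) rfl (Sub.wf_subT (W + 3)) (fun i hi => ⟨fun a ha => by cases ha; omega, fun g hg => by cases hg⟩)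
      fun i hi => wN2_ok W i (by rw [h6]; omega)
  · exact ok_of W (w := W + 3) rfl (Sub.wf_subT (W + 3)) (fun i hi => ⟨fun a ha => by cases ha; omega, fun g hg => by cases hg⟩)
      fun i hi => wNA_ok W i _
  · exact ok_of W (w := W + 2) rfl (Sub.wf_subT (W + 2)) (fun i hi => ⟨fun a ha => by cases ha; omega, fun g hg => by cases hg⟩)
      fun i hi => wNB_ok W i _
  · exact ok_of W (w := W + 2) rfl (Sub.wf_subT (W + 2)) (fun i hi => ⟨fun a ha => by cases ha; omega, fun g hg => by cases hg⟩)
      fun i hi => wN_ok W i _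
  · exact ok_of W (w := W + 2) rfl (Adder.wf_addT false (W + 2)) (fun i hi => wN_ok W i _) fun i hi => wNA_ok W i _
  · refine ok_of W (w := W + 3) rfl (Sub.wf_subT (W + 3)) (fun i hi => ⟨fun a ha => by cases ha; omega, fun g hg => by cases hg⟩)
      fun i hi => ?_
    rw [h11]; split_ifs <;> exact ⟨fun a ha => (by cases ha), fun g hg => by cases hg; omega⟩
  · refine ok_of W (w := W + 1) rfl (Sub.wf_subT (W + 1)) (fun i hi => ?_) fun i hi => wN_ok W i _
    split_ifs <;> exact ⟨fun a ha => by cases ha; omega, fun g hg => by cases hg⟩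
  · exact ok_of W (w := W + 1) rfl (Adder.wf_addT false (W + 1)) (fun i hi => wN_ok W i _) fun i hi => wNB_ok W i _
  · refine ok_of W (w := W + 2) rfl (Sub.wf_subT (W + 2)) (fun i hi => ⟨fun a ha => by cases ha; omega, fun g hg => by cases hg⟩)
      fun i hi => ?_
    rw [h14]; split_ifs <;> exact ⟨fun a ha => (by cases ha), fun g hg => by cases hg; omega⟩

end AssocQuot

/-- **The auxiliary template is well formed** (`6W + 8` inputs). [cite: Vollmer1999, Def. 1.6] -/
theorem wf_quotAuxT (W : ℕ) : (quotAuxT W).WF (6 * W + 8) := wf_layout (AssocQuot.pieces W) (AssocQuot.piece_ok W)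

/-- Size of the auxiliary template: `41W + 90` gates. [folklore] -/
@[simp] theorem length_quotAuxT (W : ℕ) : (quotAuxT W).length = 41 * W + 90 := by
  rw [quotAuxT, length_layout]; exact (AssocQuot.offsets W).2.2.2.2.2.2.2.2.2.2.2.2.2.2

/-! ### Views of the quotient occurrence -/

namespace AssocQuot

open SplitAux AssocMain

/-- The first operand of a two-operand wiring. [folklore] -/
theorem wiring2_x {w : ℕ} (x y : ℕ → ℕ ⊕ ℕ) {i : ℕ} (hi : i < w) : wiring2 w x y i = x i := by simp [wiring2, hi]

/-- The second operand of a two-operand wiring. [folklore] -/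
theorem wiring2_y {w : ℕ} (x y : ℕ → ℕ ⊕ ℕ) (i : ℕ) : wiring2 w x y (w + i) = y i := by simp [wiring2]

/-- A zero extension above its width. [folklore] -/
theorem zext_ge (z : ℕ → ℕ) (f : ℕ) {W i : ℕ} (h : W ≤ i) : Adder.zext z f W i = f := by
  unfold Adder.zext; rw [if_neg (by omega)]

/-- Operands of an embedded adder view. [folklore] -/
theorem _root_.Literature.Computability.MetaComplexity.Adder.viewEmb_x (I : Inst) (w : ℕ → ℕ ⊕ ℕ) (off W i : ℕ) :
    (Adder.viewEmb I w off W).x i = I.ref (w i) := rfl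

/-- Operands of an embedded adder view. [folklore] -/
theorem _root_.Literature.Computability.MetaComplexity.Adder.viewEmb_y (I : Inst) (w : ℕ → ℕ ⊕ ℕ) (off W i : ℕ) :
    (Adder.viewEmb I w off W).y i = I.ref (w (W + i)) := rfl

/-- Operands of an embedded subtractor view. [folklore] -/
theorem _root_.Literature.Computability.MetaComplexity.Sub.viewEmb_x (I : Inst) (wv : ℕ → ℕ ⊕ ℕ) (off w i : ℕ) :
    (Sub.viewEmb I wv off w).x i = I.ref (wv i) := rfl

/-- Operands of an embedded subtractor view. [folklore] -/
theorem _root_.Literature.Computability.MetaComplexity.Sub.viewEmb_y (I : Inst) (wv : ℕ → ℕ ⊕ ℕ) (off w i : ℕ) :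
    (Sub.viewEmb I wv off w).y i = I.ref (wv (w + i)) := rfl

variable (W : ℕ) (o₁ oA oB bA bB q : Occ) (baseV : ℕ)

/-- `n` zero-extended by the fixed `⊥` gate (at any width). [folklore] -/
def next : ℕ → ℕ := Adder.zext (nv W o₁) (f W o₁) W

/-- The masks of `oA`, zero-extended (`W+1` bits). [folklore] -/
def NA : ℕ → ℕ := Adder.zext (M bA) (f W oA) W

/-- The masks of `oA` on `W+2` bits. [folklore] -/
def NAe : ℕ → ℕ := Adder.zext (NA W oA bA) (f W o₁) (W + 1)

/-- The masks of `oB`, zero-extended (`W+1` bits). [folklore] -/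
def NB : ℕ → ℕ := Adder.zext (M bB) (f W oB) W

/-- The combined adder `V = extOut P_B + zext N_A` (`W+2` bits) at base `baseV`. [folklore] -/
def Vv : Adder.View := ⟨baseV, Adder.extOut (P W oB bB) (W + 1), NAe W o₁ oA bA⟩

/-- The adder `n + n`. [folklore] -/
def NNv : Adder.View := ⟨q.base, nv W o₁, nv W o₁⟩

/-- `2n` zero-extended. [folklore] -/
def N2e : ℕ → ℕ := Adder.zext (Adder.extOut (NNv W o₁ q) W) (f W o₁) (W + 1)

/-- The data of `0 + n < n + n`: `S = C0`, `P = Z0`, `Q = NN`, `T = Tz`. [folklore] -/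
def mZ : Sub.MonoData := ⟨q.base + (4 * W + 2), q.base + (2 * W + 1), q.base, q.base + (7 * W + 3), fun _ => f W o₁, nv W o₁, nv W o₁, W⟩

/-- The data of transitivity `V < n < 2n`: `S₁ = CV1`, `S₂ = CnN`, `S₃ = CV2`. [folklore] -/
def tD : Sub.TransData :=
  ⟨q.base + (13 * W + 17), q.base + (10 * W + 7), q.base + (16 * W + 27), Adder.extOut (Vv W o₁ oA oB bA bB baseV) (W + 2),
    next W o₁, N2e W o₁ q, W + 3⟩

/-- The data of `V ≥ zext N_A`: `P = V`, `T = TgV`. [folklore] -/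
def gV : Sub.GeData := ⟨baseV, q.base + (19 * W + 37), Adder.extOut (P W oB bB) (W + 1), NAe W o₁ oA bA, f W o₁, W + 2⟩

/-- The data of `P_B ≥ zext N_B`: `P = P_B`, `T = TgP`. [folklore] -/
def gP : Sub.GeData := ⟨bB.base + W, q.base + (22 * W + 47), Adder.zext (u W oB) (f W oB) W, NB W oB bB, f W o₁, W + 1⟩

/-- The data of monotonicity on `W+2` bits: `S = CL`, `P = V`, `Q = QB`, `T = TBm`. [folklore] -/
def mB : Sub.MonoData :=
  ⟨q.base + (25 * W + 54), baseV, q.base + (28 * W + 61), q.base + (30 * W + 66), Adder.extOut (P W oB bB) (W + 1), next W o₁,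
    NAe W o₁ oA bA, W + 2⟩

/-- The data of monotonicity on `W+1` bits: `S = CLr`, `P = P_B`, `Q = QA`, `T = TAm`. [folklore] -/
def mA : Sub.MonoData :=
  ⟨q.base + (33 * W + 76), bB.base + W, q.base + (36 * W + 80), q.base + (38 * W + 83), Adder.zext (u W oB) (f W oB) W, next W o₁,
    NB W oB bB, W + 1⟩

/-- `QWired`: the inputs of the quotient occurrence. [folklore] -/
structure QWired : Prop where
  /-- `n` -/
  hn : ∀ i < W, q.inp i = nv W o₁ i
  /-- the inner result -/
  hres : ∀ i < W, q.inp (W + i) = u W oB i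
  /-- the masks of `oA` -/
  hMA : ∀ i < W, q.inp (2 * W + i) = M bA i
  /-- the `⊥` gate of `oA` -/
  hfA : q.inp (3 * W) = f W oA
  /-- the masks of `oB` -/
  hMB : ∀ i < W, q.inp (3 * W + 1 + i) = M bB i
  /-- the `⊥` gate of `oB` -/
  hfB : q.inp (4 * W + 1) = f W oB
  /-- the fixed `⊥` gate -/
  hfz : q.inp (4 * W + 2) = f W o₁
  /-- the output word of `P_B` -/
  hPB : ∀ i < W + 2, q.inp (4 * W + 3 + i) = Adder.extOut (P W oB bB) (W + 1) i
  /-- the output word of `V` -/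
  hV : ∀ i < W + 3, q.inp (5 * W + 5 + i) = Adder.extOut (Vv W o₁ oA oB bA bB baseV) (W + 2) i

/-- `QuotViews`: the definition lines of the fifteen pieces are available. [folklore] -/
structure QuotViews (K : PropForm ℕ) (Γ : Set (PropForm ℕ)) : Prop where
  /-- `n + n` -/
  nn : (NNv W o₁ q).Avail K Γ false W
  /-- `Z0 = 0 + n` -/
  z0 : (mZ W o₁ q).P.Avail K Γ false W
  /-- comparator of `0` with `n` -/
  c0 : (mZ W o₁ q).S.Avail K Γ W
  /-- comparator of `0 + n` with `n + n` -/
  tz : (mZ W o₁ q).T.Avail K Γ (W + 1)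
  /-- comparator of `n` with `2n` -/
  cnn : (tD W o₁ oA oB bA bB q baseV).S₂.Avail K Γ (W + 3)
  /-- comparator of `V` with `n` -/
  cv1 : (tD W o₁ oA oB bA bB q baseV).S₁.Avail K Γ (W + 3)
  /-- comparator of `V` with `2n` -/
  cv2 : (tD W o₁ oA oB bA bB q baseV).S₃.Avail K Γ (W + 3)
  /-- comparator of `V` with `zext N_A` -/
  tgv : (gV W o₁ oA oB bA bB q baseV).T.Avail K Γ (W + 3)
  /-- comparator of `P_B` with `zext N_B` -/
  tgp : (gP W o₁ oB bB q).T.Avail K Γ (W + 2)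
  /-- comparator of `P_B` with `n` -/
  cl : (mB W o₁ oA oB bA bB q baseV).S.Avail K Γ (W + 2)
  /-- `QB = n + zext N_A` -/
  qb : (mB W o₁ oA oB bA bB q baseV).Q.Avail K Γ false (W + 2)
  /-- comparator of `V` with `QB` -/
  tbm : (mB W o₁ oA oB bA bB q baseV).T.Avail K Γ (W + 3)
  /-- comparator of `zext res` with `n` -/
  clr : (mA W o₁ oB bB q).S.Avail K Γ (W + 1)
  /-- `QA = n + zext N_B` -/
  qa : (mA W o₁ oB bB q).Q.Avail K Γ false (W + 1)
  /-- comparator of `P_B` with `QA` -/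
  tam : (mA W o₁ oB bB q).T.Avail K Γ (W + 2)

variable {W o₁ oA oB bA bB q baseV}

/-- Availability of the quotient views is monotone. [folklore] -/
theorem QuotViews.mono {K : PropForm ℕ} {Γ Γ' : Set (PropForm ℕ)} (h : QuotViews W o₁ oA oB bA bB q baseV K Γ) (hΓ : Γ ⊆ Γ') :
    QuotViews W o₁ oA oB bA bB q baseV K Γ' :=
  ⟨h.nn.mono hΓ, h.z0.mono hΓ, h.c0.mono hΓ, h.tz.mono hΓ, h.cnn.mono hΓ, h.cv1.mono hΓ, h.cv2.mono hΓ, h.tgv.mono hΓ, h.tgp.mono hΓ,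
    h.cl.mono hΓ, h.qb.mono hΓ, h.tbm.mono hΓ, h.clr.mono hΓ, h.qa.mono hΓ, h.tam.mono hΓ⟩

/-- **An available, correctly wired quotient occurrence provides the quotient views.** [folklore] -/
theorem quotAvail {K : PropForm ℕ} {Γ : Set (PropForm ℕ)} (hq : q.Avail (quotAuxT W) (6 * W + 8) K Γ)
    (hw : QWired W o₁ oA oB bA bB q baseV) : QuotViews W o₁ oA oB bA bB q baseV K Γ := by
  obtain ⟨h1, h2, h3, h4, h5, h6, h7, h8, h9, h10, h11, h12, h13, h14, -⟩ := offsets W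
  have hI : (q.inst (6 * W + 8)).DefsAvail (layout (pieces W) 15) K Γ := hq
  have href : ∀ i < 6 * W + 8, (q.inst (6 * W + 8)).ref (Sum.inl i) = q.inp i := fun i hi => q.ref_inl hi
  have rg : ∀ g, (q.inst (6 * W + 8)).ref (Sum.inr g) = q.base + g := fun g => rfl
  -- the recurring operand computations
  have en : ∀ i < W, nv W o₁ i = (q.inst (6 * W + 8)).ref (Sum.inl i) := fun i hi => by rw [href i (by omega), hw.hn i hi]
  have eN : ∀ i < W + 3, next W o₁ i = (q.inst (6 * W + 8)).ref (wN W i) := fun i hi => by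
    by_cases hi' : i < W
    · rw [wN, if_pos hi', next, Adder.zext_lt _ _ hi', en i hi']
    · rw [wN, if_neg hi', next, zext_ge _ _ (not_lt.1 hi'), href _ (by omega), hw.hfz]
  have eN2 : ∀ i < W + 3, N2e W o₁ q i = (q.inst (6 * W + 8)).ref (wN2 W i) := fun i hi => by
    by_cases hi' : i < W
    · rw [wN2, if_pos hi', N2e, Adder.zext_lt _ _ (by omega), Adder.extOut_lt _ hi', rg]; rfl
    · by_cases hi'' : i = W
      · rw [wN2, if_neg hi', if_pos hi'', hi'', N2e, Adder.zext_lt _ _ (by omega), Adder.extOut_top, rg]; rfl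
      · rw [wN2, if_neg hi', if_neg hi'', N2e, zext_ge _ _ (by omega), href _ (by omega), hw.hfz]
  have eNAe : ∀ i < W + 2, NAe W o₁ oA bA i = (q.inst (6 * W + 8)).ref (wNA W i) := fun i hi => by
    by_cases hi' : i < W
    · rw [wNA, if_pos hi', NAe, Adder.zext_lt _ _ (by omega), NA, Adder.zext_lt _ _ hi', href _ (by omega), hw.hMA i hi']
    · by_cases hi'' : i = W
      · rw [wNA, if_neg hi', if_pos hi'', hi'', NAe, Adder.zext_lt _ _ (by omega), NA, Adder.zext_top, href _ (by omega), hw.hfA]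
      · rw [wNA, if_neg hi', if_neg hi'', NAe, zext_ge _ _ (by omega), href _ (by omega), hw.hfz]
  have eNA3 : ∀ i < W + 3, Adder.zext (NAe W o₁ oA bA) (f W o₁) (W + 2) i = (q.inst (6 * W + 8)).ref (wNA W i) := fun i hi => by
    rcases Nat.lt_succ_iff_lt_or_eq.1 hi with hi' | hi'
    · rw [Adder.zext_lt _ _ hi', eNAe i hi']
    · rw [hi', Adder.zext_top, wNA, if_neg (by omega), if_neg (by omega), href _ (by omega), hw.hfz]
  have eNB : ∀ i < W + 1, NB W oB bB i = (q.inst (6 * W + 8)).ref (wNB W i) := fun i hi => by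
    rcases Nat.lt_succ_iff_lt_or_eq.1 hi with hi' | hi'
    · rw [wNB, if_pos hi', NB, Adder.zext_lt _ _ hi', href _ (by omega), hw.hMB i hi']
    · rw [hi', wNB, if_neg (lt_irrefl W), if_pos rfl, NB, Adder.zext_top, href _ (by omega), hw.hfB]
  have eNB2 : ∀ i < W + 2, Adder.zext (NB W oB bB) (f W o₁) (W + 1) i = (q.inst (6 * W + 8)).ref (wNB W i) := fun i hi => by
    rcases Nat.lt_succ_iff_lt_or_eq.1 hi with hi' | hi'
    · rw [Adder.zext_lt _ _ hi', eNB i hi']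
    · rw [hi', Adder.zext_top, wNB, if_neg (by omega), if_neg (by omega), href _ (by omega), hw.hfz]
  have ePB : ∀ i < W + 2, Adder.extOut (P W oB bB) (W + 1) i = (q.inst (6 * W + 8)).ref (Sum.inl (4 * W + 3 + i)) := fun i hi => by
    rw [href _ (by omega), hw.hPB i hi]
  have eV : ∀ i < W + 3, Adder.extOut (Vv W o₁ oA oB bA bB baseV) (W + 2) i = (q.inst (6 * W + 8)).ref (Sum.inl (5 * W + 5 + i)) :=
    fun i hi => by rw [href _ (by omega), hw.hV i hi]
  have eres : ∀ i < W + 1, Adder.zext (u W oB) (f W oB) W i = (q.inst (6 * W + 8)).ref (if i < W then Sum.inl (W + i) else Sum.inl (4 * W + 1)) :=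
    fun i hi => by
    rcases Nat.lt_succ_iff_lt_or_eq.1 hi with hi' | hi'
    · rw [if_pos hi', Adder.zext_lt _ _ hi', href _ (by omega), hw.hres i hi']
    · rw [hi', if_neg (lt_irrefl W), Adder.zext_top, href _ (by omega), hw.hfB]
  have efz : ∀ i : ℕ, f W o₁ = (q.inst (6 * W + 8)).ref (Sum.inl (4 * W + 2)) := fun _ => by rw [href _ (by omega), hw.hfz]
  refine ⟨?_, ?_, ?_, ?_, ?_, ?_, ?_, ?_, ?_, ?_, ?_, ?_, ?_, ?_, ?_⟩
  · -- `NN`, piece 0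
    have h := Adder.avail_viewEmb (c₀ := false) (W := W) (off := offset (pieces W) 0) (w := wiring2 W (fun i => Sum.inl i) fun i => Sum.inl i)
      hI fun k hk => getElem_layout (pieces W) (k := 0) (N := 15) (by omega) hk
    rw [offset_zero, Nat.add_zero] at h
    exact h.congr rfl (fun i hi => by rw [Adder.viewEmb_x, wiring2_x _ _ hi]; exact en i hi) fun i hi => by rw [Adder.viewEmb_y, wiring2_y]; exact en i hi
  · -- `Z0`, piece 1
    have h := Adder.avail_viewEmb (c₀ := false) (W := W) (off := offset (pieces W) 1) (w := wiring2 W (fun _ => Sum.inl (4 * W + 2)) fun i => Sum.inl i)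
      hI fun k hk => getElem_layout (pieces W) (k := 1) (N := 15) (by omega) hk
    rw [h1] at h
    exact h.congr rfl (fun i hi => by rw [Adder.viewEmb_x, wiring2_x _ _ hi]; exact efz i) fun i hi => by rw [Adder.viewEmb_y, wiring2_y]; exact en i hi
  · -- `C0`, piece 2
    have h := Sub.avail_viewEmb (w := W) (off := offset (pieces W) 2) (wv := wiring2 W (fun _ => Sum.inl (4 * W + 2)) fun i => Sum.inl i)
      hI fun k hk => getElem_layout (pieces W) (k := 2) (N := 15) (by omega) hk
    rw [h2] at h
    exact h.congr rfl (fun i hi => by rw [Sub.viewEmb_x, wiring2_x _ _ hi]; exact efz i) fun i hi => by rw [Sub.viewEmb_y, wiring2_y]; exact en i hi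
  · -- `Tz`, piece 3
    have h := Sub.avail_viewEmb (w := W + 1) (off := offset (pieces W) 3)
      (wv := wiring2 (W + 1) (fun i => if i < W then Sum.inr (2 * W + 1 + (2 * i + 1)) else Sum.inr (2 * W + 1 + 2 * W))
        fun i => if i < W then Sum.inr (2 * i + 1) else Sum.inr (2 * W))
      hI fun k hk => getElem_layout (pieces W) (k := 3) (N := 15) (by omega) hk
    rw [h3] at h
    refine h.congr rfl (fun i hi => ?_) fun i hi => ?_
    · rw [Sub.viewEmb_x, wiring2_x _ _ hi]
      show Adder.extOut (mZ W o₁ q).P W i = _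
      rcases Nat.lt_succ_iff_lt_or_eq.1 hi with hi' | hi'
      · rw [if_pos hi', Adder.extOut_lt _ hi', rg]; simp [mZ, Sub.MonoData.P, Adder.View.s, Adder.View.wire, Nat.add_assoc]
      · rw [if_neg (by omega), hi', Adder.extOut_top, rg]; simp [mZ, Sub.MonoData.P, Adder.View.c, Adder.View.wire, Nat.add_assoc]
    · rw [Sub.viewEmb_y, wiring2_y]
      show Adder.extOut (mZ W o₁ q).Q W i = _
      rcases Nat.lt_succ_iff_lt_or_eq.1 hi with hi' | hi'
      · rw [if_pos hi', Adder.extOut_lt _ hi', rg]; rfl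
      · rw [if_neg (by omega), hi', Adder.extOut_top, rg]; rfl
  · -- `CnN`, piece 4
    have h := Sub.avail_viewEmb (w := W + 3) (off := offset (pieces W) 4) (wv := wiring2 (W + 3) (wN W) (wN2 W))
      hI fun k hk => getElem_layout (pieces W) (k := 4) (N := 15) (by omega) hk
    rw [h4] at h
    exact h.congr rfl (fun i hi => by rw [Sub.viewEmb_x, wiring2_x _ _ hi]; exact eN i hi) fun i hi => by rw [Sub.viewEmb_y, wiring2_y]; exact eN2 i hi
  · -- `CV1`, piece 5
    have h := Sub.avail_viewEmb (w := W + 3) (off := offset (pieces W) 5) (wv := wiring2 (W + 3) (fun i => Sum.inl (5 * W + 5 + i)) (wN W))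
      hI fun k hk => getElem_layout (pieces W) (k := 5) (N := 15) (by omega) hk
    rw [h5] at h
    exact h.congr rfl (fun i hi => by rw [Sub.viewEmb_x, wiring2_x _ _ hi]; exact eV i hi) fun i hi => by rw [Sub.viewEmb_y, wiring2_y]; exact eN i hi
  · -- `CV2`, piece 6
    have h := Sub.avail_viewEmb (w := W + 3) (off := offset (pieces W) 6) (wv := wiring2 (W + 3) (fun i => Sum.inl (5 * W + 5 + i)) (wN2 W))
      hI fun k hk => getElem_layout (pieces W) (k := 6) (N := 15) (by omega) hk
    rw [h6] at h
    exact h.congr rfl (fun i hi => by rw [Sub.viewEmb_x, wiring2_x _ _ hi]; exact eV i hi) fun i hi => by rw [Sub.viewEmb_y, wiring2_y]; exact eN2 i hi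
  · -- `TgV`, piece 7
    have h := Sub.avail_viewEmb (w := W + 3) (off := offset (pieces W) 7) (wv := wiring2 (W + 3) (fun i => Sum.inl (5 * W + 5 + i)) (wNA W))
      hI fun k hk => getElem_layout (pieces W) (k := 7) (N := 15) (by omega) hk
    rw [h7] at h
    exact h.congr rfl (fun i hi => by rw [Sub.viewEmb_x, wiring2_x _ _ hi]; exact eV i hi) fun i hi => by rw [Sub.viewEmb_y, wiring2_y]; exact eNA3 i hi
  · -- `TgP`, piece 8
    have h := Sub.avail_viewEmb (w := W + 2) (off := offset (pieces W) 8) (wv := wiring2 (W + 2) (fun i => Sum.inl (4 * W + 3 + i)) (wNB W))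
      hI fun k hk => getElem_layout (pieces W) (k := 8) (N := 15) (by omega) hk
    rw [h8] at h
    exact h.congr rfl (fun i hi => by rw [Sub.viewEmb_x, wiring2_x _ _ hi]; exact ePB i hi) fun i hi => by rw [Sub.viewEmb_y, wiring2_y]; exact eNB2 i hi
  · -- `CL`, piece 9
    have h := Sub.avail_viewEmb (w := W + 2) (off := offset (pieces W) 9) (wv := wiring2 (W + 2) (fun i => Sum.inl (4 * W + 3 + i)) (wN W))
      hI fun k hk => getElem_layout (pieces W) (k := 9) (N := 15) (by omega) hk
    rw [h9] at h
    exact h.congr rfl (fun i hi => by rw [Sub.viewEmb_x, wiring2_x _ _ hi]; exact ePB i hi) fun i hi => by rw [Sub.viewEmb_y, wiring2_y]; exact eN i (by omega)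
  · -- `QB`, piece 10
    have h := Adder.avail_viewEmb (c₀ := false) (W := W + 2) (off := offset (pieces W) 10) (w := wiring2 (W + 2) (wN W) (wNA W))
      hI fun k hk => getElem_layout (pieces W) (k := 10) (N := 15) (by omega) hk
    rw [h10] at h
    exact h.congr rfl (fun i hi => by rw [Adder.viewEmb_x, wiring2_x _ _ hi]; exact eN i (by omega)) fun i hi => by rw [Adder.viewEmb_y, wiring2_y]; exact eNAe i hi
  · -- `TBm`, piece 11
    have h := Sub.avail_viewEmb (w := W + 3) (off := offset (pieces W) 11)
      (wv := wiring2 (W + 3) (fun i => Sum.inl (5 * W + 5 + i))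
        fun i => if i < W + 2 then Sum.inr (28 * W + 61 + (2 * i + 1)) else Sum.inr (28 * W + 61 + 2 * (W + 2)))
      hI fun k hk => getElem_layout (pieces W) (k := 11) (N := 15) (by omega) hk
    rw [h11] at h
    refine h.congr rfl (fun i hi => by rw [Sub.viewEmb_x, wiring2_x _ _ hi]; exact eV i hi) fun i hi => ?_
    rw [Sub.viewEmb_y, wiring2_y]
    show Adder.extOut (mB W o₁ oA oB bA bB q baseV).Q (W + 2) i = _
    rcases Nat.lt_succ_iff_lt_or_eq.1 hi with hi' | hi'
    · rw [if_pos hi', Adder.extOut_lt _ hi', rg]; simp [mB, Sub.MonoData.Q, Adder.View.s, Adder.View.wire, Nat.add_assoc]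
    · rw [if_neg (by omega), hi', Adder.extOut_top, rg]; simp [mB, Sub.MonoData.Q, Adder.View.c, Adder.View.wire, Nat.add_assoc]
  · -- `CLr`, piece 12
    have h := Sub.avail_viewEmb (w := W + 1) (off := offset (pieces W) 12)
      (wv := wiring2 (W + 1) (fun i => if i < W then Sum.inl (W + i) else Sum.inl (4 * W + 1)) (wN W))
      hI fun k hk => getElem_layout (pieces W) (k := 12) (N := 15) (by omega) hk
    rw [h12] at h
    exact h.congr rfl (fun i hi => by rw [Sub.viewEmb_x, wiring2_x _ _ hi]; exact eres i hi) fun i hi => by rw [Sub.viewEmb_y, wiring2_y]; exact eN i (by omega)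
  · -- `QA`, piece 13
    have h := Adder.avail_viewEmb (c₀ := false) (W := W + 1) (off := offset (pieces W) 13) (w := wiring2 (W + 1) (wN W) (wNB W))
      hI fun k hk => getElem_layout (pieces W) (k := 13) (N := 15) (by omega) hk
    rw [h13] at h
    exact h.congr rfl (fun i hi => by rw [Adder.viewEmb_x, wiring2_x _ _ hi]; exact eN i (by omega)) fun i hi => by rw [Adder.viewEmb_y, wiring2_y]; exact eNB i hi
  · -- `TAm`, piece 14
    have h := Sub.avail_viewEmb (w := W + 2) (off := offset (pieces W) 14)
      (wv := wiring2 (W + 2) (fun i => Sum.inl (4 * W + 3 + i))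
        fun i => if i < W + 1 then Sum.inr (36 * W + 80 + (2 * i + 1)) else Sum.inr (36 * W + 80 + 2 * (W + 1)))
      hI fun k hk => getElem_layout (pieces W) (k := 14) (N := 15) (by omega) hk
    rw [h14] at h
    refine h.congr rfl (fun i hi => by rw [Sub.viewEmb_x, wiring2_x _ _ hi]; exact ePB i hi) fun i hi => ?_
    rw [Sub.viewEmb_y, wiring2_y]
    show Adder.extOut (mA W o₁ oB bB q).Q (W + 1) i = _
    rcases Nat.lt_succ_iff_lt_or_eq.1 hi with hi' | hi'
    · rw [if_pos hi', Adder.extOut_lt _ hi', rg]; simp [mA, Sub.MonoData.Q, Adder.View.s, Adder.View.wire, Nat.add_assoc]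
    · rw [if_neg (by omega), hi', Adder.extOut_top, rg]; simp [mA, Sub.MonoData.Q, Adder.View.c, Adder.View.wire, Nat.add_assoc]

/-! ### Generic steps on comparators -/

section Steps

variable {G : FregeSystem} {K : PropForm ℕ} {Γ : Set (PropForm ℕ)}

/-- **A comparator position over two false operand bits**: `ge (j+1) ↔ ge j` (the general-position
form of `ModAdd.topEqv`). [cite: CookReckhow1979, §2] -/
theorem posEqv (hG : ARulesOK G) (V : Sub.View) {w j : ℕ} (hV : V.Avail K Γ w) (hj : j < w) (hx : ctx K (neg (var (V.x j))) ∈ Γ)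
    (hy : ctx K (neg (var (V.y j))) ∈ Γ) : G.Yields Γ {ctx K (eqv (V.ge w (j + 1)) (V.ge w j))} (K.size + 10) := by
  have h := Yields.single (FregeSystem.IsInferredFrom.of_rule (hG.modAdd _ ModAdd.mem_rules.2.2.1) (S := Γ)
    (FregeSystem.sub [K, var (V.ny j), var (V.y j), var (V.ge w (j + 1)), var (V.x j), var (V.ge w j)])
    (θ := ctx K (eqv (V.ge w (j + 1)) (V.ge w j))) rfl
    (FregeSystem.prems_cons (hV.1 j hj) (FregeSystem.prems_cons (hV.2.2 j hj).2
      (FregeSystem.prems_cons hx (FregeSystem.prems_cons hy FregeSystem.prems_nil)))))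
  exact h.mono_size (by simp [ctx, eqv, size, FregeSystem.size_biimp])

/-- The lines lifting a literal of `ge j₀` to `ge (j₀ + k)` over false operand positions: for each
step `ge (j+1) ↔ ge j`, its symmetric form, and the literal of `ge (j+1)`. [folklore] -/
def liftBody (V : Sub.View) (w j₀ : ℕ) (pos : Bool) (t : ℕ) : PropForm ℕ :=
  if t % 3 = 0 then eqv (V.ge w (j₀ + t / 3 + 1)) (V.ge w (j₀ + t / 3))
  else if t % 3 = 1 then eqv (V.ge w (j₀ + t / 3)) (V.ge w (j₀ + t / 3 + 1)) else lit (V.ge w (j₀ + t / 3 + 1)) pos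

/-- First line of a step. [folklore] -/
theorem liftBody_0 (V : Sub.View) (w j₀ : ℕ) (pos : Bool) {t : ℕ} (h : t % 3 = 0) :
    liftBody V w j₀ pos t = eqv (V.ge w (j₀ + t / 3 + 1)) (V.ge w (j₀ + t / 3)) := by unfold liftBody; rw [if_pos h]
/-- Second line of a step. [folklore] -/
theorem liftBody_1 (V : Sub.View) (w j₀ : ℕ) (pos : Bool) {t : ℕ} (h : t % 3 = 1) :
    liftBody V w j₀ pos t = eqv (V.ge w (j₀ + t / 3)) (V.ge w (j₀ + t / 3 + 1)) := by unfold liftBody; rw [if_neg (by omega), if_pos h]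
/-- Third line of a step. [folklore] -/
theorem liftBody_2 (V : Sub.View) (w j₀ : ℕ) (pos : Bool) {t : ℕ} (h : t % 3 = 2) :
    liftBody V w j₀ pos t = lit (V.ge w (j₀ + t / 3 + 1)) pos := by unfold liftBody; rw [if_neg (by omega), if_neg (by omega)]

/-- The lift lines for `k` steps. [folklore] -/
def liftList (V : Sub.View) (w j₀ : ℕ) (pos : Bool) (k : ℕ) : List (PropForm ℕ) := (List.range (3 * k)).map (liftBody V w j₀ pos)

/-- The lifted literal is among the lift lines. [folklore] -/
theorem lit_mem_liftList (V : Sub.View) (w j₀ : ℕ) (pos : Bool) {k : ℕ} (hk : 0 < k) : lit (V.ge w (j₀ + k)) pos ∈ liftList V w j₀ pos k :=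
  List.mem_map.2 ⟨3 * k - 1, List.mem_range.2 (by omega), by rw [liftBody_2 _ _ _ _ (by omega), show j₀ + (3 * k - 1) / 3 + 1 = j₀ + k by omega]⟩

/-- Sizes of the lift lines. [folklore] -/
theorem size_liftBody (V : Sub.View) (w j₀ : ℕ) (pos : Bool) (t : ℕ) : (liftBody V w j₀ pos t).size ≤ 9 := by
  unfold liftBody; split_ifs
  · exact (size_eqv _ _).le
  · exact (size_eqv _ _).le
  · cases pos <;> simp [lit, size]

/-- **Lifting a comparison literal over false operand positions**: from the literal of `ge j₀` and
false operand bits at positions `j₀ … j₀+k-1`, the same literal of `ge (j₀+k)`.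
[cite: CookReckhow1979, §2] -/
theorem lift (hG : ARulesOK G) (V : Sub.View) {w j₀ k : ℕ} (pos : Bool) (hV : V.Avail K Γ w) (hk : j₀ + k ≤ w)
    (h₀ : ctx K (lit (V.ge w j₀) pos) ∈ Γ) (hx : ∀ j, j₀ ≤ j → j < j₀ + k → ctx K (neg (var (V.x j))) ∈ Γ)
    (hy : ∀ j, j₀ ≤ j → j < j₀ + k → ctx K (neg (var (V.y j))) ∈ Γ) :
    G.Yields Γ (ctxSet K (liftList V w j₀ pos k)) (3 * k * (K.size + 9 + 1)) := by
  rw [liftList, ctxSet_map_range]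
  refine Yields.indexed (line := fun t => ctx K (liftBody V w j₀ pos t)) (fun t ht => Or.inr ?_) fun t _ => by
    simpa [ctx, size] using size_liftBody V w j₀ pos t
  have hj : j₀ + t / 3 < w := by omega
  obtain hr | hr | hr : t % 3 = 0 ∨ t % 3 = 1 ∨ t % 3 = 2 := by omega
  · show G.IsInferredFrom _ (ctx K (liftBody V w j₀ pos t))
    rw [liftBody_0 _ _ _ _ hr]
    exact FregeSystem.IsInferredFrom.of_rule (hG.modAdd _ ModAdd.mem_rules.2.2.1)
      (FregeSystem.sub [K, var (V.ny (j₀ + t / 3)), var (V.y (j₀ + t / 3)), var (V.ge w (j₀ + t / 3 + 1)), var (V.x (j₀ + t / 3)),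
        var (V.ge w (j₀ + t / 3))]) rfl
      (FregeSystem.prems_cons (Or.inl (hV.1 _ hj)) (FregeSystem.prems_cons (Or.inl (hV.2.2 _ hj).2)
        (FregeSystem.prems_cons (Or.inl (hx _ (by omega) (by omega))) (FregeSystem.prems_cons (Or.inl (hy _ (by omega) (by omega)))
        FregeSystem.prems_nil))))
  · show G.IsInferredFrom _ (ctx K (liftBody V w j₀ pos t))
    rw [liftBody_1 _ _ _ _ hr]
    exact Logic.infer hG.logic 5 (by decide) (FregeSystem.sub [K, var (V.ge w (j₀ + t / 3 + 1)), var (V.ge w (j₀ + t / 3))]) rfl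
      (FregeSystem.prems_cons (Or.inr ⟨t - 1, by omega, by
        rw [liftBody_0 _ _ _ _ (by omega), show (t - 1) / 3 = t / 3 by omega]; rfl⟩) FregeSystem.prems_nil)
  · show G.IsInferredFrom _ (ctx K (liftBody V w j₀ pos t))
    rw [liftBody_2 _ _ _ _ hr]
    have hprev : ctx K (lit (V.ge w (j₀ + t / 3)) pos) ∈ Γ ∪ {χ | ∃ j < t, χ = ctx K (liftBody V w j₀ pos j)} := by
      rcases Nat.eq_zero_or_pos (t / 3) with hu | hu
      · rw [hu, Nat.add_zero]; exact Or.inl h₀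
      · exact Or.inr ⟨t - 3, by omega, by rw [liftBody_2 _ _ _ _ (by omega), show j₀ + (t - 3) / 3 + 1 = j₀ + t / 3 by omega]⟩
    have heq : ctx K (eqv (V.ge w (j₀ + t / 3)) (V.ge w (j₀ + t / 3 + 1))) ∈ Γ ∪ {χ | ∃ j < t, χ = ctx K (liftBody V w j₀ pos j)} :=
      Or.inr ⟨t - 1, by omega, by rw [liftBody_1 _ _ _ _ (by omega), show (t - 1) / 3 = t / 3 by omega]⟩
    cases pos
    · exact Logic.infer hG.logic 8 (by decide) (FregeSystem.sub [K, var (V.ge w (j₀ + t / 3)), var (V.ge w (j₀ + t / 3 + 1))]) rfl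
        (FregeSystem.prems_cons hprev (FregeSystem.prems_cons heq FregeSystem.prems_nil))
    · exact Logic.infer hG.logic 7 (by decide) (FregeSystem.sub [K, var (V.ge w (j₀ + t / 3)), var (V.ge w (j₀ + t / 3 + 1))]) rfl
        (FregeSystem.prems_cons hprev (FregeSystem.prems_cons heq FregeSystem.prems_nil))

/-- The `ge` line of a comparator congruence. [folklore] -/
theorem ge_mem_leibLines (S T : Sub.View) (K : PropForm ℕ) (w : ℕ) : ctx K (eqv (S.ge w w) (T.ge w w)) ∈ Sub.leibLines S T K w :=
  Sub.mem_leibLines (k := 2 * w) (by omega)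

/-- **Equal bits, pairwise false**: `W'` equalities between two words whose bits are all false.
[cite: CookReckhow1979, §2] -/
theorem eqW_of_negs (hG : ARulesOK G) {a b : ℕ → ℕ} {W' : ℕ} (ha : ∀ i < W', ctx K (neg (var (a i))) ∈ Γ)
    (hb : ∀ i < W', ctx K (neg (var (b i))) ∈ Γ) : G.Yields Γ (ctxSet K (eqW a b W')) (W' * (K.size + 9 + 1)) :=
  Yields.ctx_range (fun i hi => Or.inr (Logic.infer hG.logic 10 (by decide) (FregeSystem.sub [K, var (a i), var (b i)]) rfl
    (FregeSystem.prems_cons (ha i hi) (FregeSystem.prems_cons (hb i hi) FregeSystem.prems_nil)))) fun _ _ => (size_eqv _ _).le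

end Steps

/-! ### Common derivations -/

section Common

variable {G : FregeSystem} {K : PropForm ℕ} {Γ : Set (PropForm ℕ)} {W : ℕ} {o₁ oA oB bA bB q : Occ} {baseV : ℕ}

/-- **Masks under a true selector**: `mask_i ↔ n_i`. [cite: CookReckhow1979, §2] -/
theorem masksOn (hG : ARulesOK G) {o b : Occ} (hm : ∀ i < W, ctx K (biimp (var (M b i)) (conj (var (sel W o)) (var (nv W o i)))) ∈ Γ)
    (hn : ∀ i < W, nv W o i = nv W o₁ i) (hsel : ctx K (var (sel W o)) ∈ Γ) :
    G.Yields Γ (ctxSet K (eqW (M b) (nv W o₁) W)) (W * (K.size + 9 + 1)) :=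
  Yields.ctx_range (fun i hi => Or.inr (Logic.infer hG.logic 15 (by decide) (FregeSystem.sub [K, var (M b i), var (sel W o), var (nv W o₁ i)])
    rfl (FregeSystem.prems_cons (by rw [← hn i hi]; exact hm i hi) (FregeSystem.prems_cons hsel FregeSystem.prems_nil))))
    fun _ _ => (size_eqv _ _).le

/-- **Masks under a false selector**: `¬mask_i`. [cite: CookReckhow1979, §2] -/
theorem masksOff (hG : ARulesOK G) {o b : Occ} (hm : ∀ i < W, ctx K (biimp (var (M b i)) (conj (var (sel W o)) (var (nv W o i)))) ∈ Γ)
    (hnsel : ctx K (neg (var (sel W o))) ∈ Γ) :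
    G.Yields Γ (ctxSet K ((List.range W).map fun i => neg (var (M b i)))) (W * (K.size + 2 + 1)) :=
  Yields.ctx_range (fun i hi => Or.inr (Logic.infer hG.logic 16 (by decide) (FregeSystem.sub [K, var (M b i), var (sel W o), var (nv W o i)])
    rfl (FregeSystem.prems_cons (hm i hi) (FregeSystem.prems_cons hnsel FregeSystem.prems_nil)))) fun _ _ => by simp [size]

/-- The lines `extOut QB = 2n` (`W+3` positions, as `s`/`c` of `QB` against `N2e`). [folklore] -/
def qbBodies (W : ℕ) (o₁ oA oB bA bB q : Occ) (baseV : ℕ) : List (PropForm ℕ) :=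
  (List.range (W + 2)).map (fun i => eqv ((mB W o₁ oA oB bA bB q baseV).Q.s i) (N2e W o₁ q i)) ++
    [eqv ((mB W o₁ oA oB bA bB q baseV).Q.c (W + 2)) (N2e W o₁ q (W + 2))]

/-- The `QB` lines give the word equality `extOut QB (W+2) = N2e`. [folklore] -/
theorem holds_qb (h : Holds K Γ (qbBodies W o₁ oA oB bA bB q baseV)) :
    ∀ i < W + 3, ctx K (eqv (Adder.extOut (mB W o₁ oA oB bA bB q baseV).Q (W + 2) i) (N2e W o₁ q i)) ∈ Γ := fun i hi => by
  rcases Nat.lt_succ_iff_lt_or_eq.1 hi with hi' | hi'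
  · rw [Adder.extOut_lt _ hi']; exact h _ (List.mem_append_left _ (List.mem_map.2 ⟨i, List.mem_range.2 hi', rfl⟩))
  · rw [hi', Adder.extOut_top]; exact h _ (List.mem_append_right _ (List.mem_singleton_self _))

/-- **`QB = n + zext N_A` equals `2n` when the masks of `oA` are on.** From the mask equalities
`N_A ≡ n` and the literals of the `⊥` gates: congruence with `n + n` on the low wires and the two
top positions over false bits. [cite: CookReckhow1979, §2] [cite: Krajicek1995, §9.2] -/
theorem qbWord (hG : ARulesOK G) (qv : QuotViews W o₁ oA oB bA bB q baseV K Γ) (hmA : Holds K Γ (eqW (M bA) (nv W o₁) W))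
    (hfz : ctx K (neg (var (f W o₁))) ∈ Γ) (hfA : ctx K (neg (var (f W oA))) ∈ Γ) :
    G.Yields Γ (ctxSet K (qbBodies W o₁ oA oB bA bB q baseV)) ((3 * W + 12) * (K.size + 10)) := by
  -- b1: reflexivity of `n`
  have b1 := Yields.eqW_refl hG.adder K (nv W o₁) W (Γ := Γ)
  set A1 := ctxSet K (eqW (nv W o₁) (nv W o₁) W) with hA1
  -- b2: congruence of `QB` (low `W` positions) with `n + n`
  have b2 : G.Yields (Γ ∪ A1) {χ | χ ∈ Adder.leibLines (mB W o₁ oA oB bA bB q baseV).Q (NNv W o₁ q) K W} ((2 * W + 1) * (K.size + 10)) := by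
    refine Yields.of_isBlock (Adder.isBlock_leibLines hG.netlist (mB W o₁ oA oB bA bB q baseV).Q (NNv W o₁ q)
      ((qv.qb.of_le (by omega)).mono Set.subset_union_left) (qv.nn.mono Set.subset_union_left) (fun i hi => ?_) fun i hi => ?_)
      subset_rfl (Adder.proofSize_leibLines _ _ _ _)
    · show ctx K (eqv (next W o₁ i) (nv W o₁ i)) ∈ Γ ∪ A1
      rw [next, Adder.zext_lt _ _ hi]; exact Or.inr (mem_ctxSet (mem_eqW hi))
    · show ctx K (eqv (NAe W o₁ oA bA i) (nv W o₁ i)) ∈ Γ ∪ A1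
      rw [NAe, Adder.zext_lt _ _ (by omega), NA, Adder.zext_lt _ _ hi]; exact Or.inl (holds_eqW_iff.1 hmA i hi)
  set A2 := A1 ∪ {χ | χ ∈ Adder.leibLines (mB W o₁ oA oB bA bB q baseV).Q (NNv W o₁ q) K W} with hA2
  -- b3: position `W` of `QB` (over `fz`, `fA`), position `W+1` (over `fz`, `fz`)
  have b3 := (topCC hG (mB W o₁ oA oB bA bB q baseV).Q ((qv.qb.of_le (by omega)).mono (Set.subset_union_left (t := A2)))
    (show next W o₁ W = f W o₁ from Adder.zext_top _ _ _)
    (show NAe W o₁ oA bA W = f W oA by rw [NAe, Adder.zext_lt _ _ (Nat.lt_succ_self W), NA, Adder.zext_top]) (Or.inl hfz) (Or.inl hfA)).union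
    (topCC hG (mB W o₁ oA oB bA bB q baseV).Q (qv.qb.mono Set.subset_union_left)
    (show next W o₁ (W + 1) = f W o₁ from zext_ge _ _ (Nat.le_succ W)) (show NAe W o₁ oA bA (W + 1) = f W o₁ from Adder.zext_top _ _ _)
    (Or.inl hfz) (Or.inl hfz))
  set A3 := A2 ∪ (({ctx K (eqv ((mB W o₁ oA oB bA bB q baseV).Q.s W) ((mB W o₁ oA oB bA bB q baseV).Q.c W))} ∪
    {ctx K (neg (var ((mB W o₁ oA oB bA bB q baseV).Q.c (W + 1))))}) ∪
    ({ctx K (eqv ((mB W o₁ oA oB bA bB q baseV).Q.s (W + 1)) ((mB W o₁ oA oB bA bB q baseV).Q.c (W + 1)))} ∪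
    {ctx K (neg (var ((mB W o₁ oA oB bA bB q baseV).Q.c (W + 1 + 1))))})) with hA3
  -- b4: `¬s_{W+1}(QB)`; `s_W(QB) ↔ c_W(NN)`
  have b4 := (DomAux.negTransport hG.toRulesOK (K := K) (Γ := Γ ∪ A3) (x := (mB W o₁ oA oB bA bB q baseV).Q.c (W + 1))
    (y := (mB W o₁ oA oB bA bB q baseV).Q.s (W + 1)) (Or.inr (Or.inr (Or.inl (Or.inr rfl)))) (Or.inr (Or.inr (Or.inr (Or.inl rfl))))).union
    (eqvTrans hG (x := (mB W o₁ oA oB bA bB q baseV).Q.s W) (y := (mB W o₁ oA oB bA bB q baseV).Q.c W) (z := (NNv W o₁ q).c W)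
      (Or.inr (Or.inr (Or.inl (Or.inl rfl)))) (Or.inr (Or.inl (Or.inr (Adder.mem_leibLines (k := 2 * W) (by omega))))))
  set A4 := A3 ∪ ({ctx K (neg (var ((mB W o₁ oA oB bA bB q baseV).Q.s (W + 1))))} ∪
    {ctx K (eqv ((mB W o₁ oA oB bA bB q baseV).Q.s W) ((NNv W o₁ q).c W))}) with hA4
  -- b5: the two false top positions against `fz`
  have b5 := (eqvFF hG (K := K) (Γ := Γ ∪ A4) (x := (mB W o₁ oA oB bA bB q baseV).Q.s (W + 1)) (y := f W o₁) (Or.inr (Or.inr (Or.inl rfl)))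
    (Or.inl hfz)).union
    (eqvFF hG (K := K) (Γ := Γ ∪ A4) (x := (mB W o₁ oA oB bA bB q baseV).Q.c (W + 2)) (y := f W o₁)
      (Or.inr (Or.inl (Or.inr (Or.inr (Or.inr rfl))))) (Or.inl hfz))
  have h := (((b1.trans b2).trans b3).trans b4).trans b5
  refine (h.mono_right ?_).mono_size (by nlinarith [Nat.zero_le W, Nat.zero_le K.size])
  rintro θ ⟨L, hL, rfl⟩
  rcases List.mem_append.1 hL with hL | hL
  · obtain ⟨i, hi, rfl⟩ := List.mem_map.1 hL
    have hi' := List.mem_range.1 hi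
    by_cases hiW : i < W
    · rw [N2e, Adder.zext_lt _ _ (by omega), Adder.extOut_lt _ hiW]
      exact Or.inl (Or.inl (Or.inl (Or.inr (Adder.mem_leibLines (k := 2 * i + 1) (by omega)))))
    · rcases Nat.lt_succ_iff_lt_or_eq.1 hi' with hi'' | hi''
      · rw [show i = W by omega, N2e, Adder.zext_lt _ _ (Nat.lt_succ_self W), Adder.extOut_top]; exact Or.inl (Or.inr (Or.inr rfl))
      · rw [hi'', N2e, Adder.zext_top]; exact Or.inr (Or.inl rfl)
  · rw [List.mem_singleton.1 hL, N2e, zext_ge _ _ (by omega)]; exact Or.inr (Or.inr rfl)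

/-- The lines `2n = extOut QA` (`W+2` positions). [folklore] -/
def qaBodies (W : ℕ) (o₁ oB bB q : Occ) : List (PropForm ℕ) :=
  (List.range (W + 1)).map (fun i => eqv (N2e W o₁ q i) ((mA W o₁ oB bB q).Q.s i)) ++ [eqv (N2e W o₁ q (W + 1)) ((mA W o₁ oB bB q).Q.c (W + 1))]

/-- The `QA` lines give the word equality `N2e = extOut QA (W+1)`. [folklore] -/
theorem holds_qa (h : Holds K Γ (qaBodies W o₁ oB bB q)) :
    ∀ i < W + 2, ctx K (eqv (N2e W o₁ q i) (Adder.extOut (mA W o₁ oB bB q).Q (W + 1) i)) ∈ Γ := fun i hi => by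
  rcases Nat.lt_succ_iff_lt_or_eq.1 hi with hi' | hi'
  · rw [Adder.extOut_lt _ hi']; exact h _ (List.mem_append_left _ (List.mem_map.2 ⟨i, List.mem_range.2 hi', rfl⟩))
  · rw [hi', Adder.extOut_top]; exact h _ (List.mem_append_right _ (List.mem_singleton_self _))

/-- **`QA = n + zext N_B` equals `2n` when the masks of `oB` are on.** [cite: CookReckhow1979, §2]
[cite: Krajicek1995, §9.2] -/
theorem qaWord (hG : ARulesOK G) (qv : QuotViews W o₁ oA oB bA bB q baseV K Γ) (hmB : Holds K Γ (eqW (M bB) (nv W o₁) W))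
    (hfz : ctx K (neg (var (f W o₁))) ∈ Γ) (hfB : ctx K (neg (var (f W oB))) ∈ Γ) :
    G.Yields Γ (ctxSet K (qaBodies W o₁ oB bB q)) ((4 * W + 12) * (K.size + 10)) := by
  -- a1: reflexivity of `n`, and the masks reversed
  have a1 := (Yields.eqW_refl hG.adder K (nv W o₁) W (Γ := Γ)).union (Yields.eqW_symm hG.logic hmB)
  set A1 := ctxSet K (eqW (nv W o₁) (nv W o₁) W) ∪ ctxSet K (eqW (nv W o₁) (M bB) W) with hA1
  -- a2: congruence of `n + n` with `QA` (low `W` positions)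
  have a2 : G.Yields (Γ ∪ A1) {χ | χ ∈ Adder.leibLines (NNv W o₁ q) (mA W o₁ oB bB q).Q K W} ((2 * W + 1) * (K.size + 10)) := by
    refine Yields.of_isBlock (Adder.isBlock_leibLines hG.netlist (NNv W o₁ q) (mA W o₁ oB bB q).Q (qv.nn.mono Set.subset_union_left)
      ((qv.qa.of_le (by omega)).mono Set.subset_union_left) (fun i hi => ?_) fun i hi => ?_) subset_rfl (Adder.proofSize_leibLines _ _ _ _)
    · show ctx K (eqv (nv W o₁ i) (next W o₁ i)) ∈ Γ ∪ A1
      rw [next, Adder.zext_lt _ _ hi]; exact Or.inr (Or.inl (mem_ctxSet (mem_eqW hi)))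
    · show ctx K (eqv (nv W o₁ i) (NB W oB bB i)) ∈ Γ ∪ A1
      rw [NB, Adder.zext_lt _ _ hi]; exact Or.inr (Or.inr (mem_ctxSet (mem_eqW (b := M bB) hi)))
  set A2 := A1 ∪ {χ | χ ∈ Adder.leibLines (NNv W o₁ q) (mA W o₁ oB bB q).Q K W} with hA2
  -- a3: position `W` of `QA` (over `fz`, `fB`)
  have a3 := topCC hG (mA W o₁ oB bB q).Q (qv.qa.mono (Set.subset_union_left (t := A2))) (show next W o₁ W = f W o₁ from Adder.zext_top _ _ _)
    (show NB W oB bB W = f W oB from Adder.zext_top _ _ _) (Or.inl hfz) (Or.inl hfB)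
  set A3 := A2 ∪ ({ctx K (eqv ((mA W o₁ oB bB q).Q.s W) ((mA W o₁ oB bB q).Q.c W))} ∪ {ctx K (neg (var ((mA W o₁ oB bB q).Q.c (W + 1))))})
    with hA3
  -- a4: `c_W(QA) ↔ s_W(QA)`, then `c_W(NN) ↔ s_W(QA)`; `fz ↔ c_{W+1}(QA)`
  have a4 := eqvSymm hG (K := K) (Γ := Γ ∪ A3) (x := (mA W o₁ oB bB q).Q.s W) (y := (mA W o₁ oB bB q).Q.c W) (Or.inr (Or.inr (Or.inl rfl)))
  set A4 := A3 ∪ {ctx K (eqv ((mA W o₁ oB bB q).Q.c W) ((mA W o₁ oB bB q).Q.s W))} with hA4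
  have a5 := (eqvTrans hG (K := K) (Γ := Γ ∪ A4) (x := (NNv W o₁ q).c W) (y := (mA W o₁ oB bB q).Q.c W) (z := (mA W o₁ oB bB q).Q.s W)
    (Or.inr (Or.inl (Or.inl (Or.inr (Adder.mem_leibLines (k := 2 * W) (by omega)))))) (Or.inr (Or.inr rfl))).union
    (eqvFF hG (K := K) (Γ := Γ ∪ A4) (x := f W o₁) (y := (mA W o₁ oB bB q).Q.c (W + 1)) (Or.inl hfz) (Or.inr (Or.inl (Or.inr (Or.inr rfl)))))
  have h := (((a1.trans a2).trans a3).trans a4).trans a5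
  refine (h.mono_right ?_).mono_size (by nlinarith [Nat.zero_le W, Nat.zero_le K.size])
  rintro θ ⟨L, hL, rfl⟩
  rcases List.mem_append.1 hL with hL | hL
  · obtain ⟨i, hi, rfl⟩ := List.mem_map.1 hL
    rcases Nat.lt_succ_iff_lt_or_eq.1 (List.mem_range.1 hi) with hi' | hi'
    · rw [N2e, Adder.zext_lt _ _ (by omega), Adder.extOut_lt _ hi']
      exact Or.inl (Or.inl (Or.inl (Or.inr (Adder.mem_leibLines (k := 2 * i + 1) (by omega)))))
    · rw [hi', N2e, Adder.zext_lt _ _ (Nat.lt_succ_self W), Adder.extOut_top]; exact Or.inr (Or.inl rfl)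
  · rw [List.mem_singleton.1 hL, N2e, Adder.zext_top]; exact Or.inr (Or.inr rfl)

/-- **`zext res < n` on `W+1` bits** (the reference comparator `CLr`), from the certificate `res < n`.
[cite: CookReckhow1979, §2] -/
theorem resLt (hG : ARulesOK G) (qv : QuotViews W o₁ oA oB bA bB q baseV K Γ) (hres : LtN W K Γ (u W oB) (nv W o₁))
    (hfz : ctx K (neg (var (f W o₁))) ∈ Γ) (hfB : ctx K (neg (var (f W oB))) ∈ Γ) :
    G.Yields Γ {ctx K (neg (var ((mA W o₁ oB bB q).S.ge (W + 1) (W + 1))))} ((7 * W + 10) * (K.size + 10)) := by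
  have r1 := (Yields.eqW_refl hG.adder K (u W oB) W (Γ := Γ)).union (Yields.eqW_refl hG.adder K (nv W o₁) W)
  set A1 := ctxSet K (eqW (u W oB) (u W oB) W) ∪ ctxSet K (eqW (nv W o₁) (nv W o₁) W) with hA1
  have r2 : G.Yields (Γ ∪ A1) {ctx K (neg (var ((mA W o₁ oB bB q).S.ge (W + 1) W)))} ((3 * W + 2) * (K.size + 10)) := by
    refine (hres.mono Set.subset_union_left).transport hG.toRulesOK (mA W o₁ oB bB q).S (qv.clr.mono Set.subset_union_left) (Nat.le_succ W)
      (fun i hi => ?_) fun i hi => ?_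
    · show ctx K (eqv (u W oB i) (Adder.zext (u W oB) (f W oB) W i)) ∈ Γ ∪ A1
      rw [Adder.zext_lt _ _ hi]; exact Or.inr (Or.inl (mem_ctxSet (mem_eqW hi)))
    · show ctx K (eqv (nv W o₁ i) (next W o₁ i)) ∈ Γ ∪ A1
      rw [next, Adder.zext_lt _ _ hi]; exact Or.inr (Or.inr (mem_ctxSet (mem_eqW hi)))
  set A2 := A1 ∪ {ctx K (neg (var ((mA W o₁ oB bB q).S.ge (W + 1) W)))} with hA2
  have r3 : G.Yields (Γ ∪ A2) (ctxSet K (liftList (mA W o₁ oB bB q).S (W + 1) W false 1)) (3 * 1 * (K.size + 9 + 1)) := by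
    refine lift hG (mA W o₁ oB bB q).S false (qv.clr.mono Set.subset_union_left) le_rfl (Or.inr (Or.inr rfl)) (fun j hj hj' => ?_) fun j hj hj' => ?_
    · show ctx K (neg (var (Adder.zext (u W oB) (f W oB) W j))) ∈ Γ ∪ A2
      rw [show j = W by omega, Adder.zext_top]; exact Or.inl hfB
    · show ctx K (neg (var (next W o₁ j))) ∈ Γ ∪ A2
      rw [next, zext_ge _ _ hj]; exact Or.inl hfz
  have h := (r1.trans r2).trans r3
  refine (h.mono_right fun θ hθ => ?_).mono_size (by nlinarith [Nat.zero_le W, Nat.zero_le K.size])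
  rw [Set.mem_singleton_iff.1 hθ]; exact Or.inr (mem_ctxSet (lit_mem_liftList (mA W o₁ oB bB q).S (W + 1) W false Nat.one_pos))

/-- **`n < 2n` on `W+3` bits** (the comparator `CnN`), from the global certificate `0 < n`: `0 + n < n + n`
by monotonicity, `0 + n = n` by the zero law, linked to `CnN` and lifted over the false top positions.
[cite: CookReckhow1979, §2] [cite: Krajicek1995, §9.2] -/
theorem nLt2n (hG : ARulesOK G) (qv : QuotViews W o₁ oA oB bA bB q baseV K Γ) {zw : ℕ → ℕ} (hz : Holds K Γ (litW zw (fun _ => false) W))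
    (hzlt : LtN W K Γ zw (nv W o₁)) (hfz : ctx K (neg (var (f W o₁))) ∈ Γ) :
    G.Yields Γ {ctx K (neg (var ((tD W o₁ oA oB bA bB q baseV).S₂.ge (W + 3) (W + 3))))} ((16 * W + 30) * (K.size + 60)) := by
  -- n1: `zw ≡ fz` (both false), reflexivity of `n` and of `extOut NN`
  have n1 := ((eqW_of_negs hG (K := K) (Γ := Γ) (a := zw) (b := fun _ => f W o₁) (W' := W) (fun i hi => hz _ (mem_litW (bits := fun _ => false) hi))
    fun _ _ => hfz).union (Yields.eqW_refl hG.adder K (nv W o₁) W)).union (Yields.eqW_refl hG.adder K (Adder.extOut (NNv W o₁ q) W) (W + 1))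
  set A1 := (ctxSet K (eqW zw (fun _ => f W o₁) W) ∪ ctxSet K (eqW (nv W o₁) (nv W o₁) W)) ∪
    ctxSet K (eqW (Adder.extOut (NNv W o₁ q) W) (Adder.extOut (NNv W o₁ q) W) (W + 1)) with hA1
  -- n2: `0 < n` transported to `C0`
  have n2 : G.Yields (Γ ∪ A1) {ctx K (neg (var ((mZ W o₁ q).S.ge W W)))} ((3 * W + 2) * (K.size + 10)) :=
    (hzlt.mono Set.subset_union_left).transport hG.toRulesOK (mZ W o₁ q).S (qv.c0.mono Set.subset_union_left) le_rfl
      (fun i hi => Or.inr (Or.inl (Or.inl (mem_ctxSet (mem_eqW (b := fun _ => f W o₁) hi))))) fun i hi => Or.inr (Or.inl (Or.inr (mem_ctxSet (mem_eqW hi))))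
  set A2 := A1 ∪ {ctx K (neg (var ((mZ W o₁ q).S.ge W W)))} with hA2
  -- n3: monotonicity `0 + n < n + n`
  have n3 : G.Yields (Γ ∪ A2) {χ | χ ∈ (mZ W o₁ q).lines K ++ [ctx K (neg (var ((mZ W o₁ q).T.ge (W + 1) (W + 1))))]} ((W + 2) * (K.size + 55)) :=
    Yields.of_isBlock (Sub.MonoData.isBlock_mono hG.order (mZ W o₁ q) (qv.c0.mono Set.subset_union_left) (qv.z0.mono Set.subset_union_left)
      (qv.nn.mono Set.subset_union_left) (qv.tz.mono Set.subset_union_left) (Or.inr (Or.inr rfl))) subset_rfl (Sub.MonoData.proofSize_mono _ _ _)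
  set A3 := A2 ∪ {χ | χ ∈ (mZ W o₁ q).lines K ++ [ctx K (neg (var ((mZ W o₁ q).T.ge (W + 1) (W + 1))))]} with hA3
  -- n4: the zero law `0 + n = n` for `Z0`
  have n4 : G.Yields (Γ ∪ A3) (ctxSet K ((List.range (2 * W + 1)).map (zeroLLine (mZ W o₁ q).P))) ((2 * W + 1) * (K.size + 10)) :=
    zeroL hG.toRulesOK (mZ W o₁ q).P (qv.z0.mono Set.subset_union_left) fun _ _ => Or.inl hfz
  set A4 := A3 ∪ ctxSet K ((List.range (2 * W + 1)).map (zeroLLine (mZ W o₁ q).P)) with hA4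
  -- n5: `n_i ↔ s_i(Z0)`, `fz ↔ c_W(Z0)`
  have n5 := (Yields.eqW_symm hG.logic (K := K) (Γ := Γ ∪ A4) (a := (mZ W o₁ q).P.s) (b := nv W o₁) (W := W)
    (holds_eqW_iff.2 fun i hi => Or.inr (Or.inr (mem_ctxSet (sum_mem_zeroL (mZ W o₁ q).P hi))))).union
    (eqvFF hG (K := K) (Γ := Γ ∪ A4) (x := f W o₁) (y := (mZ W o₁ q).P.c W) (Or.inl hfz) (Or.inr (Or.inr (mem_ctxSet (carry_mem_zeroL (mZ W o₁ q).P le_rfl)))))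
  set A5 := A4 ∪ (ctxSet K (eqW (nv W o₁) (mZ W o₁ q).P.s W) ∪ {ctx K (eqv (f W o₁) ((mZ W o₁ q).P.c W))}) with hA5
  -- n6: link `CnN` with `Tz` on `W+1` positions
  have n6 : G.Yields (Γ ∪ A5) (ctxSet K (linkLines (tD W o₁ oA oB bA bB q baseV).S₂ (mZ W o₁ q).T (W + 3) (W + 1) (W + 1)))
      ((3 * (W + 1) + 1) * (K.size + 10)) := by
    refine linkLow hG.toRulesOK (tD W o₁ oA oB bA bB q baseV).S₂ (mZ W o₁ q).T (qv.cnn.mono Set.subset_union_left) (qv.tz.mono Set.subset_union_left)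
      (by omega) le_rfl (fun i hi => ?_) fun i hi => ?_
    · show ctx K (eqv (next W o₁ i) (Adder.extOut (mZ W o₁ q).P W i)) ∈ Γ ∪ A5
      rcases Nat.lt_succ_iff_lt_or_eq.1 hi with hi' | hi'
      · rw [next, Adder.zext_lt _ _ hi', Adder.extOut_lt _ hi']; exact Or.inr (Or.inr (Or.inl (mem_ctxSet (mem_eqW (b := (mZ W o₁ q).P.s) hi'))))
      · rw [hi', next, Adder.zext_top, Adder.extOut_top]; exact Or.inr (Or.inr (Or.inr rfl))
    · show ctx K (eqv (N2e W o₁ q i) (Adder.extOut (NNv W o₁ q) W i)) ∈ Γ ∪ A5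
      rw [N2e, Adder.zext_lt _ _ hi]; exact Or.inr (Or.inl (Or.inl (Or.inl (Or.inl (Or.inr (mem_ctxSet (mem_eqW hi)))))))
  set A6 := A5 ∪ ctxSet K (linkLines (tD W o₁ oA oB bA bB q baseV).S₂ (mZ W o₁ q).T (W + 3) (W + 1) (W + 1)) with hA6
  -- n7: `¬ge_{W+1}(CnN)`, lifted to `W+3`
  have n7 : G.Yields (Γ ∪ A6) {ctx K (neg (var ((tD W o₁ oA oB bA bB q baseV).S₂.ge (W + 3) (W + 1))))} (2 * (K.size + 10)) :=
    DomAux.negTransport hG.toRulesOK (Or.inr (Or.inl (Or.inl (Or.inl (Or.inr (List.mem_append_right _ (List.mem_singleton_self _)))))))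
      (Or.inr (Or.inr (mem_ctxSet (ge_mem_linkLines _ _ _ _ _))))
  set A7 := A6 ∪ {ctx K (neg (var ((tD W o₁ oA oB bA bB q baseV).S₂.ge (W + 3) (W + 1))))} with hA7
  have n8 : G.Yields (Γ ∪ A7) (ctxSet K (liftList (tD W o₁ oA oB bA bB q baseV).S₂ (W + 3) (W + 1) false 2)) (3 * 2 * (K.size + 9 + 1)) := by
    refine lift hG (tD W o₁ oA oB bA bB q baseV).S₂ false (qv.cnn.mono Set.subset_union_left) le_rfl (Or.inr (Or.inr rfl)) (fun j hj hj' => ?_)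
      fun j hj hj' => ?_
    · show ctx K (neg (var (next W o₁ j))) ∈ Γ ∪ A7
      rw [next, zext_ge _ _ (by omega)]; exact Or.inl hfz
    · show ctx K (neg (var (N2e W o₁ q j))) ∈ Γ ∪ A7
      rcases Nat.lt_succ_iff_lt_or_eq.1 (show j < W + 1 + 1 + 1 by omega) with hj'' | hj''
      · rw [show j = W + 1 by omega, N2e, Adder.zext_top]; exact Or.inl hfz
      · rw [hj'', N2e, zext_ge _ _ (by omega)]; exact Or.inl hfz
  have h := ((((((n1.trans n2).trans n3).trans n4).trans n5).trans n6).trans n7).trans n8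
  refine (h.mono_right fun θ hθ => ?_).mono_size (by nlinarith [Nat.zero_le W, Nat.zero_le K.size])
  rw [Set.mem_singleton_iff.1 hθ]
  exact Or.inr (mem_ctxSet (lit_mem_liftList (tD W o₁ oA oB bA bB q baseV).S₂ (W + 3) (W + 1) false (by norm_num)))

/-- The conclusions of the quotient analysis: `[V ≥ n] ↔ (G_A ∨ G_B)` and `[V ≥ 2n] ↔ (G_A ∧ G_B)`.
[folklore] -/
def concl (W : ℕ) (o₁ oA oB bA bB q : Occ) (baseV : ℕ) : List (PropForm ℕ) :=
  [biimp (var ((tD W o₁ oA oB bA bB q baseV).S₁.ge (W + 3) (W + 3))) (disj (var (sel W oA)) (var (sel W oB))),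
    biimp (var ((tD W o₁ oA oB bA bB q baseV).S₃.ge (W + 3) (W + 3))) (conj (var (sel W oA)) (var (sel W oB)))]

/-- Sizes of the conclusions. [folklore] -/
theorem size_of_mem_concl {L : PropForm ℕ} (h : L ∈ concl W o₁ oA oB bA bB q baseV) : L.size ≤ 13 := by
  simp only [concl, List.mem_cons, List.not_mem_nil, or_false] at h
  rcases h with rfl | rfl <;> simp [FregeSystem.size_biimp, size]

end Common

/-! ### The four leaves of the case analysis -/

section Leaves

variable {G : FregeSystem} {K : PropForm ℕ} {Γ : Set (PropForm ℕ)} {W : ℕ} {o₁ oA oB bA bB q : Occ} {baseV : ℕ}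

/-- **`[V ≥ n]` when the masks of `oA` are on**: `V = P_B + zext N_A ≥ zext N_A ≡ n`.
[cite: CookReckhow1979, §2] [cite: Krajicek1995, §9.2] -/
theorem geOne (hG : ARulesOK G) (qv : QuotViews W o₁ oA oB bA bB q baseV K Γ) (hV : (Vv W o₁ oA oB bA bB baseV).Avail K Γ false (W + 2))
    (hmA : Holds K Γ (eqW (M bA) (nv W o₁) W)) (hfz : ctx K (neg (var (f W o₁))) ∈ Γ) (hfA : ctx K (neg (var (f W oA))) ∈ Γ) :
    G.Yields Γ {ctx K (var ((tD W o₁ oA oB bA bB q baseV).S₁.ge (W + 3) (W + 3)))} ((5 * W + 24) * (K.size + 12)) := by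
  -- g1: reflexivity of `extOut V`, `fA ↔ fz`, `fz ↔ fz`
  have g1 := ((Yields.eqW_refl hG.adder K (Adder.extOut (Vv W o₁ oA oB bA bB baseV) (W + 2)) (W + 3) (Γ := Γ)).union
    (eqvFF hG (x := f W oA) (y := f W o₁) hfA hfz)).union (eqvFF hG (x := f W o₁) (y := f W o₁) hfz hfz)
  set A1 := (ctxSet K (eqW (Adder.extOut (Vv W o₁ oA oB bA bB baseV) (W + 2)) (Adder.extOut (Vv W o₁ oA oB bA bB baseV) (W + 2)) (W + 3)) ∪
    {ctx K (eqv (f W oA) (f W o₁))}) ∪ {ctx K (eqv (f W o₁) (f W o₁))} with hA1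
  -- g2: `V ≥ zext N_A`
  have g2 : G.Yields (Γ ∪ A1) {χ | χ ∈ (gV W o₁ oA oB bA bB q baseV).lines K} ((W + 2 + 2) * (K.size + 12)) :=
    Yields.of_isBlock (Sub.GeData.isBlock_lines hG.order (gV W o₁ oA oB bA bB q baseV) (hV.mono Set.subset_union_left)
      (qv.tgv.mono Set.subset_union_left) (Or.inl hfz)) subset_rfl (Sub.GeData.proofSize_lines _ _)
  set A2 := A1 ∪ {χ | χ ∈ (gV W o₁ oA oB bA bB q baseV).lines K} with hA2
  -- g3: congruence `TgV = CV1`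
  have g3 : G.Yields (Γ ∪ A2) {χ | χ ∈ Sub.leibLines (gV W o₁ oA oB bA bB q baseV).T (tD W o₁ oA oB bA bB q baseV).S₁ K (W + 3)}
      ((3 * (W + 3) + 1) * (K.size + 10)) := by
    refine Yields.of_isBlock (Sub.isBlock_leibLines hG.netlist hG.logic (gV W o₁ oA oB bA bB q baseV).T (tD W o₁ oA oB bA bB q baseV).S₁
      (qv.tgv.mono Set.subset_union_left) (qv.cv1.mono Set.subset_union_left) (fun i hi => Or.inr (Or.inl (Or.inl (Or.inl (mem_ctxSet (mem_eqW hi))))))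
      fun i hi => ?_) subset_rfl (Sub.proofSize_leibLines _ _ _ _)
    show ctx K (eqv (Adder.zext (NAe W o₁ oA bA) (f W o₁) (W + 2) i) (next W o₁ i)) ∈ Γ ∪ A2
    by_cases h0 : i < W
    · rw [Adder.zext_lt _ _ (by omega), NAe, Adder.zext_lt _ _ (by omega), NA, Adder.zext_lt _ _ h0, next, Adder.zext_lt _ _ h0]
      exact Or.inl (holds_eqW_iff.1 hmA i h0)
    · rw [next, zext_ge _ _ (not_lt.1 h0)]
      by_cases h1 : i = W
      · rw [h1, Adder.zext_lt _ _ (by omega), NAe, Adder.zext_lt _ _ (by omega), NA, Adder.zext_top]; exact Or.inr (Or.inl (Or.inl (Or.inr rfl)))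
      · by_cases h2 : i = W + 1
        · rw [h2, Adder.zext_lt _ _ (by omega), NAe, Adder.zext_top]; exact Or.inr (Or.inl (Or.inr rfl))
        · rw [show i = W + 2 by omega, Adder.zext_top]; exact Or.inr (Or.inl (Or.inr rfl))
  set A3 := A2 ∪ {χ | χ ∈ Sub.leibLines (gV W o₁ oA oB bA bB q baseV).T (tD W o₁ oA oB bA bB q baseV).S₁ K (W + 3)} with hA3
  -- g4: transport of truth
  have g4 : G.Yields (Γ ∪ A3) {ctx K (var ((tD W o₁ oA oB bA bB q baseV).S₁.ge (W + 3) (W + 3)))} (K.size + 2) := by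
    have h := Yields.single (Logic.infer hG.logic 7 (by decide) (S := Γ ∪ A3)
      (FregeSystem.sub [K, var ((gV W o₁ oA oB bA bB q baseV).T.ge (W + 3) (W + 3)), var ((tD W o₁ oA oB bA bB q baseV).S₁.ge (W + 3) (W + 3))])
      (θ := ctx K (var ((tD W o₁ oA oB bA bB q baseV).S₁.ge (W + 3) (W + 3)))) rfl
      (FregeSystem.prems_cons (Or.inr (Or.inl (Or.inr ((gV W o₁ oA oB bA bB q baseV).mem_lines K))))
        (FregeSystem.prems_cons (Or.inr (Or.inr (ge_mem_leibLines _ _ _ _))) FregeSystem.prems_nil)))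
    exact h.mono_size (by simp [ctx, size])
  have h := ((g1.trans g2).trans g3).trans g4
  exact (h.mono_right Set.subset_union_right).mono_size (by nlinarith [Nat.zero_le W, Nat.zero_le K.size])

/-- **Congruence `TBm = CV2`** from the word equality `extOut QB = 2n`. [cite: CookReckhow1979, §2] -/
theorem tbmCv2 (hG : ARulesOK G) (qv : QuotViews W o₁ oA oB bA bB q baseV K Γ) (hqb : Holds K Γ (qbBodies W o₁ oA oB bA bB q baseV)) :
    G.Yields Γ {ctx K (eqv ((mB W o₁ oA oB bA bB q baseV).T.ge (W + 3) (W + 3)) ((tD W o₁ oA oB bA bB q baseV).S₃.ge (W + 3) (W + 3)))} ((4 * W + 16) * (K.size + 10)) := by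
  have c1 := Yields.eqW_refl hG.adder K (Adder.extOut (Vv W o₁ oA oB bA bB baseV) (W + 2)) (W + 3) (Γ := Γ)
  set A1 := ctxSet K (eqW (Adder.extOut (Vv W o₁ oA oB bA bB baseV) (W + 2)) (Adder.extOut (Vv W o₁ oA oB bA bB baseV) (W + 2)) (W + 3)) with hA1
  have c2 : G.Yields (Γ ∪ A1) {χ | χ ∈ Sub.leibLines (mB W o₁ oA oB bA bB q baseV).T (tD W o₁ oA oB bA bB q baseV).S₃ K (W + 3)} ((3 * (W + 3) + 1) * (K.size + 10)) :=
    Yields.of_isBlock (Sub.isBlock_leibLines hG.netlist hG.logic (mB W o₁ oA oB bA bB q baseV).T (tD W o₁ oA oB bA bB q baseV).S₃ (qv.tbm.mono Set.subset_union_left)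
      (qv.cv2.mono Set.subset_union_left) (fun i hi => Or.inr (mem_ctxSet (mem_eqW hi))) fun i hi => Or.inl (holds_qb hqb i hi))
      subset_rfl (Sub.proofSize_leibLines _ _ _ _)
  exact ((c1.trans c2).mono_right fun θ hθ => Or.inr (by rw [Set.mem_singleton_iff.1 hθ]; exact ge_mem_leibLines _ _ _ _)).mono_size
    (by nlinarith [Nat.zero_le W, Nat.zero_le K.size])

/-- **`P_B ≥ n` when the masks of `oB` are on** (`CL` answers `≥`): `P_B = zext res + zext N_B ≥ zext N_B ≡ n`.
[cite: CookReckhow1979, §2] [cite: Krajicek1995, §9.2] -/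
theorem clTrue (hG : ARulesOK G) (qv : QuotViews W o₁ oA oB bA bB q baseV K Γ) (hPB : (P W oB bB).Avail K Γ false (W + 1))
    (hmB : Holds K Γ (eqW (M bB) (nv W o₁) W)) (hfz : ctx K (neg (var (f W o₁))) ∈ Γ) (hfB : ctx K (neg (var (f W oB))) ∈ Γ) :
    G.Yields Γ {ctx K (var ((mB W o₁ oA oB bA bB q baseV).S.ge (W + 2) (W + 2)))} ((5 * W + 20) * (K.size + 12)) := by
  have g1 := ((Yields.eqW_refl hG.adder K (Adder.extOut (P W oB bB) (W + 1)) (W + 2) (Γ := Γ)).union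
    (eqvFF hG (x := f W oB) (y := f W o₁) hfB hfz)).union (eqvFF hG (x := f W o₁) (y := f W o₁) hfz hfz)
  set A1 := (ctxSet K (eqW (Adder.extOut (P W oB bB) (W + 1)) (Adder.extOut (P W oB bB) (W + 1)) (W + 2)) ∪ {ctx K (eqv (f W oB) (f W o₁))}) ∪
    {ctx K (eqv (f W o₁) (f W o₁))} with hA1
  have g2 : G.Yields (Γ ∪ A1) {χ | χ ∈ (gP W o₁ oB bB q).lines K} ((W + 1 + 2) * (K.size + 12)) :=
    Yields.of_isBlock (Sub.GeData.isBlock_lines hG.order (gP W o₁ oB bB q) (hPB.mono Set.subset_union_left) (qv.tgp.mono Set.subset_union_left) (Or.inl hfz))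
      subset_rfl (Sub.GeData.proofSize_lines _ _)
  set A2 := A1 ∪ {χ | χ ∈ (gP W o₁ oB bB q).lines K} with hA2
  have g3 : G.Yields (Γ ∪ A2) {χ | χ ∈ Sub.leibLines (gP W o₁ oB bB q).T (mB W o₁ oA oB bA bB q baseV).S K (W + 2)} ((3 * (W + 2) + 1) * (K.size + 10)) := by
    refine Yields.of_isBlock (Sub.isBlock_leibLines hG.netlist hG.logic (gP W o₁ oB bB q).T (mB W o₁ oA oB bA bB q baseV).S (qv.tgp.mono Set.subset_union_left)
      (qv.cl.mono Set.subset_union_left) (fun i hi => Or.inr (Or.inl (Or.inl (Or.inl (mem_ctxSet (mem_eqW hi)))))) fun i hi => ?_)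
      subset_rfl (Sub.proofSize_leibLines _ _ _ _)
    show ctx K (eqv (Adder.zext (NB W oB bB) (f W o₁) (W + 1) i) (next W o₁ i)) ∈ Γ ∪ A2
    by_cases h0 : i < W
    · rw [Adder.zext_lt _ _ (by omega), NB, Adder.zext_lt _ _ h0, next, Adder.zext_lt _ _ h0]; exact Or.inl (holds_eqW_iff.1 hmB i h0)
    · rw [next, zext_ge _ _ (not_lt.1 h0)]
      by_cases h1 : i = W
      · rw [h1, Adder.zext_lt _ _ (by omega), NB, Adder.zext_top]; exact Or.inr (Or.inl (Or.inl (Or.inr rfl)))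
      · rw [show i = W + 1 by omega, Adder.zext_top]; exact Or.inr (Or.inl (Or.inr rfl))
  set A3 := A2 ∪ {χ | χ ∈ Sub.leibLines (gP W o₁ oB bB q).T (mB W o₁ oA oB bA bB q baseV).S K (W + 2)} with hA3
  have g4 : G.Yields (Γ ∪ A3) {ctx K (var ((mB W o₁ oA oB bA bB q baseV).S.ge (W + 2) (W + 2)))} (K.size + 2) := by
    have h := Yields.single (Logic.infer hG.logic 7 (by decide) (S := Γ ∪ A3)
      (FregeSystem.sub [K, var ((gP W o₁ oB bB q).T.ge (W + 2) (W + 2)), var ((mB W o₁ oA oB bA bB q baseV).S.ge (W + 2) (W + 2))]) (θ := ctx K (var ((mB W o₁ oA oB bA bB q baseV).S.ge (W + 2) (W + 2)))) rfl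
      (FregeSystem.prems_cons (Or.inr (Or.inl (Or.inr ((gP W o₁ oB bB q).mem_lines K))))
        (FregeSystem.prems_cons (Or.inr (Or.inr (ge_mem_leibLines _ _ _ _))) FregeSystem.prems_nil)))
    exact h.mono_size (by simp [ctx, size])
  have h := ((g1.trans g2).trans g3).trans g4
  exact (h.mono_right Set.subset_union_right).mono_size (by nlinarith [Nat.zero_le W, Nat.zero_le K.size])

/-- **Monotonicity, positive end**: `P_B ≥ n` gives `V = P_B + zext N_A ≥ n + zext N_A = QB`.
[cite: CookReckhow1979, §2] -/
theorem monoPos (hG : ARulesOK G) (qv : QuotViews W o₁ oA oB bA bB q baseV K Γ) (hV : (Vv W o₁ oA oB bA bB baseV).Avail K Γ false (W + 2))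
    (hS : ctx K (var ((mB W o₁ oA oB bA bB q baseV).S.ge (W + 2) (W + 2))) ∈ Γ) :
    G.Yields Γ {ctx K (var ((mB W o₁ oA oB bA bB q baseV).T.ge (W + 3) (W + 3)))} ((W + 4) * (K.size + 55)) := by
  have m1 : G.Yields Γ {χ | χ ∈ (mB W o₁ oA oB bA bB q baseV).lines K} ((W + 2 + 1) * (K.size + 55)) :=
    Yields.of_isBlock (Sub.MonoData.isBlock_lines hG.order (mB W o₁ oA oB bA bB q baseV) qv.cl hV qv.qb qv.tbm) subset_rfl (Sub.MonoData.proofSize_lines _ _)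
  obtain ⟨hnt, hct⟩ := Sub.MonoData.avail_top qv.tbm
  have m2 : G.Yields (Γ ∪ {χ | χ ∈ (mB W o₁ oA oB bA bB q baseV).lines K}) {ctx K (var ((mB W o₁ oA oB bA bB q baseV).T.ge (W + 3) (W + 3)))} (K.size + 2) := by
    have h := Yields.single (Assoc.infer hG 2 (by decide) (S := Γ ∪ {χ | χ ∈ (mB W o₁ oA oB bA bB q baseV).lines K})
      (FregeSystem.sub [K, var ((mB W o₁ oA oB bA bB q baseV).S.ge (W + 2) (W + 2)), var ((mB W o₁ oA oB bA bB q baseV).P.c (W + 2)), var ((mB W o₁ oA oB bA bB q baseV).Q.c (W + 2)), var ((mB W o₁ oA oB bA bB q baseV).T.ge (W + 3) (W + 2)),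
        var ((mB W o₁ oA oB bA bB q baseV).T.ny (W + 2)), var ((mB W o₁ oA oB bA bB q baseV).T.ge (W + 3) (W + 3))]) (θ := ctx K (var ((mB W o₁ oA oB bA bB q baseV).T.ge (W + 3) (W + 3)))) rfl
      (FregeSystem.prems_cons (Or.inr ((mB W o₁ oA oB bA bB q baseV).mem_lines K le_rfl)) (FregeSystem.prems_cons (Or.inl hS)
        (FregeSystem.prems_cons (Or.inl hnt) (FregeSystem.prems_cons (Or.inl hct) FregeSystem.prems_nil)))))
    exact h.mono_size (by simp [ctx, size])
  exact ((m1.trans m2).mono_right Set.subset_union_right).mono_size (by nlinarith [Nat.zero_le W, Nat.zero_le K.size])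

/-- **Monotonicity, strict end**: `P_B < n` gives `V < QB`. [cite: CookReckhow1979, §2] -/
theorem monoNeg (hG : ARulesOK G) (qv : QuotViews W o₁ oA oB bA bB q baseV K Γ) (hV : (Vv W o₁ oA oB bA bB baseV).Avail K Γ false (W + 2))
    (hS : ctx K (neg (var ((mB W o₁ oA oB bA bB q baseV).S.ge (W + 2) (W + 2)))) ∈ Γ) :
    G.Yields Γ {ctx K (neg (var ((mB W o₁ oA oB bA bB q baseV).T.ge (W + 3) (W + 3))))} ((W + 4) * (K.size + 55)) := by
  have m1 : G.Yields Γ {χ | χ ∈ (mB W o₁ oA oB bA bB q baseV).lines K ++ [ctx K (neg (var ((mB W o₁ oA oB bA bB q baseV).T.ge (W + 2 + 1) (W + 2 + 1))))]} ((W + 2 + 2) * (K.size + 55)) :=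
    Yields.of_isBlock (Sub.MonoData.isBlock_mono hG.order (mB W o₁ oA oB bA bB q baseV) qv.cl hV qv.qb qv.tbm hS) subset_rfl (Sub.MonoData.proofSize_mono _ _ _)
  exact (m1.mono_right fun θ hθ => by rw [Set.mem_singleton_iff.1 hθ]; exact List.mem_append_right _ (List.mem_singleton_self _)).mono_size
    (by nlinarith [Nat.zero_le W, Nat.zero_le K.size])

/-- **`P_B < n` when the masks of `oB` are off** (`CL` answers `<`): `P_B = zext res + 0 = zext res`,
linked with the reference comparator `CLr` (`zext res < n`) and lifted over the carry position.
[cite: CookReckhow1979, §2] [cite: Krajicek1995, §9.2] -/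
theorem clFalse (hG : ARulesOK G) (qv : QuotViews W o₁ oA oB bA bB q baseV K Γ) (hPB : (P W oB bB).Avail K Γ false (W + 1))
    (hmB : Holds K Γ ((List.range W).map fun i => neg (var (M bB i)))) (hfz : ctx K (neg (var (f W o₁))) ∈ Γ)
    (hfB : ctx K (neg (var (f W oB))) ∈ Γ) (hPc : ctx K (neg (var ((P W oB bB).c (W + 1)))) ∈ Γ)
    (hclr : ctx K (neg (var ((mA W o₁ oB bB q).S.ge (W + 1) (W + 1)))) ∈ Γ) :
    G.Yields Γ ({χ | χ ∈ Adder.zeroLines (P W oB bB) K (W + 1)} ∪ {ctx K (neg (var ((mB W o₁ oA oB bA bB q baseV).S.ge (W + 2) (W + 2))))}) ((6 * W + 16) * (K.size + 10)) := by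
  -- z1: the zero law for `P_B`
  have z1 : G.Yields Γ {χ | χ ∈ Adder.zeroLines (P W oB bB) K (W + 1)} ((2 * (W + 1) + 1) * (K.size + 10)) := by
    refine Yields.of_isBlock (Adder.isBlock_zeroLines hG.adderLaw (P W oB bB) hPB fun i hi => ?_) subset_rfl (Adder.proofSize_zeroLines _ _ _)
    show ctx K (neg (var (Adder.zext (M bB) (f W oB) W i))) ∈ Γ
    rcases Nat.lt_succ_iff_lt_or_eq.1 hi with hi' | hi'
    · rw [Adder.zext_lt _ _ hi']; exact hmB _ (List.mem_map.2 ⟨i, List.mem_range.2 hi', rfl⟩)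
    · rw [hi', Adder.zext_top]; exact hfB
  set A1 : Set (PropForm ℕ) := {χ | χ ∈ Adder.zeroLines (P W oB bB) K (W + 1)} with hA1
  -- z2: reflexivity of `next`, then link `CL` with `CLr` on `W+1` positions
  have z2 := Yields.eqW_refl hG.adder K (next W o₁) (W + 1) (Γ := Γ ∪ A1)
  set A2 := A1 ∪ ctxSet K (eqW (next W o₁) (next W o₁) (W + 1)) with hA2
  have z3 : G.Yields (Γ ∪ A2) (ctxSet K (linkLines (mB W o₁ oA oB bA bB q baseV).S (mA W o₁ oB bB q).S (W + 2) (W + 1) (W + 1))) ((3 * (W + 1) + 1) * (K.size + 10)) := by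
    refine linkLow hG.toRulesOK (mB W o₁ oA oB bA bB q baseV).S (mA W o₁ oB bB q).S (qv.cl.mono Set.subset_union_left) (qv.clr.mono Set.subset_union_left) (by omega) le_rfl
      (fun i hi => ?_) fun i hi => Or.inr (Or.inr (mem_ctxSet (mem_eqW hi)))
    show ctx K (eqv (Adder.extOut (P W oB bB) (W + 1) i) (Adder.zext (u W oB) (f W oB) W i)) ∈ Γ ∪ A2
    rw [Adder.extOut_lt _ hi]; exact Or.inr (Or.inl (Adder.sum_mem_zeroLines hi))
  set A3 := A2 ∪ ctxSet K (linkLines (mB W o₁ oA oB bA bB q baseV).S (mA W o₁ oB bB q).S (W + 2) (W + 1) (W + 1)) with hA3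
  -- z4: `¬ge_{W+1}(CL)`, lifted over position `W+1`
  have z4 : G.Yields (Γ ∪ A3) {ctx K (neg (var ((mB W o₁ oA oB bA bB q baseV).S.ge (W + 2) (W + 1))))} (2 * (K.size + 10)) :=
    DomAux.negTransport hG.toRulesOK (Or.inl hclr) (Or.inr (Or.inr (mem_ctxSet (ge_mem_linkLines _ _ _ _ _))))
  set A4 := A3 ∪ {ctx K (neg (var ((mB W o₁ oA oB bA bB q baseV).S.ge (W + 2) (W + 1))))} with hA4
  have z5 : G.Yields (Γ ∪ A4) (ctxSet K (liftList (mB W o₁ oA oB bA bB q baseV).S (W + 2) (W + 1) false 1)) (3 * 1 * (K.size + 9 + 1)) := by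
    refine lift hG (mB W o₁ oA oB bA bB q baseV).S false (qv.cl.mono Set.subset_union_left) le_rfl (Or.inr (Or.inr rfl)) (fun j hj hj' => ?_) fun j hj hj' => ?_
    · show ctx K (neg (var (Adder.extOut (P W oB bB) (W + 1) j))) ∈ Γ ∪ A4
      rw [show j = W + 1 by omega, Adder.extOut_top]; exact Or.inl hPc
    · show ctx K (neg (var (next W o₁ j))) ∈ Γ ∪ A4
      rw [next, zext_ge _ _ (by omega)]; exact Or.inl hfz
  have h := (((z1.trans z2).trans z3).trans z4).trans z5
  refine (h.mono_right ?_).mono_size (by nlinarith [Nat.zero_le W, Nat.zero_le K.size])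
  rintro θ (hθ | hθ)
  · exact Or.inl (Or.inl (Or.inl (Or.inl hθ)))
  · rw [Set.mem_singleton_iff.1 hθ]; exact Or.inr (mem_ctxSet (lit_mem_liftList (mB W o₁ oA oB bA bB q baseV).S (W + 2) (W + 1) false Nat.one_pos))

/-- **Leaf `G_A ∧ G_B`.** [cite: CookReckhow1979, §2] [cite: Krajicek1995, §9.2] -/
theorem leafTT (hG : ARulesOK G) (qv : QuotViews W o₁ oA oB bA bB q baseV K Γ) (hV : (Vv W o₁ oA oB bA bB baseV).Avail K Γ false (W + 2))
    (hPB : (P W oB bB).Avail K Γ false (W + 1)) (hmA : ∀ i < W, ctx K (biimp (var (M bA i)) (conj (var (sel W oA)) (var (nv W oA i)))) ∈ Γ)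
    (hmB : ∀ i < W, ctx K (biimp (var (M bB i)) (conj (var (sel W oB)) (var (nv W oB i)))) ∈ Γ) (hnA : ∀ i < W, nv W oA i = nv W o₁ i)
    (hnB : ∀ i < W, nv W oB i = nv W o₁ i) (hfz : ctx K (neg (var (f W o₁))) ∈ Γ) (hfA : ctx K (neg (var (f W oA))) ∈ Γ)
    (hfB : ctx K (neg (var (f W oB))) ∈ Γ) (hselA : ctx K (var (sel W oA)) ∈ Γ) (hselB : ctx K (var (sel W oB)) ∈ Γ) :
    G.Yields Γ (ctxSet K (concl W o₁ oA oB bA bB q baseV)) ((20 * W + 100) * (K.size + 60)) := by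
  have hΓ : ∀ {X : Set (PropForm ℕ)}, Γ ⊆ Γ ∪ X := fun {X} => Set.subset_union_left
  have l1 := (masksOn hG hmA hnA hselA).union (masksOn hG hmB hnB hselB)
  set A1 := ctxSet K (eqW (M bA) (nv W o₁) W) ∪ ctxSet K (eqW (M bB) (nv W o₁) W) with hA1
  have hMA : ∀ {X : Set (PropForm ℕ)}, A1 ⊆ X → Holds K (Γ ∪ X) (eqW (M bA) (nv W o₁) W) := fun hX =>
    holds_ctxSet fun θ hθ => Or.inr (hX (Or.inl hθ))
  have hMB : ∀ {X : Set (PropForm ℕ)}, A1 ⊆ X → Holds K (Γ ∪ X) (eqW (M bB) (nv W o₁) W) := fun hX =>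
    holds_ctxSet fun θ hθ => Or.inr (hX (Or.inr hθ))
  have l2 := geOne hG (qv.mono hΓ) (hV.mono hΓ) (hMA subset_rfl) (hΓ hfz) (hΓ hfA)
  set A2 := A1 ∪ {ctx K (var ((tD W o₁ oA oB bA bB q baseV).S₁.ge (W + 3) (W + 3)))} with hA2
  have l3 := clTrue hG (qv.mono (hΓ (X := A2))) (hPB.mono hΓ) (hMB fun θ hθ => Or.inl hθ) (hΓ hfz) (hΓ hfB)
  set A3 := A2 ∪ {ctx K (var ((mB W o₁ oA oB bA bB q baseV).S.ge (W + 2) (W + 2)))} with hA3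
  have l4 := monoPos hG (qv.mono (hΓ (X := A3))) (hV.mono hΓ) (Or.inr (Or.inr rfl))
  set A4 := A3 ∪ {ctx K (var ((mB W o₁ oA oB bA bB q baseV).T.ge (W + 3) (W + 3)))} with hA4
  have l5 := qbWord hG (qv.mono (hΓ (X := A4))) (hMA fun θ hθ => Or.inl (Or.inl (Or.inl hθ))) (hΓ hfz) (hΓ hfA)
  set A5 := A4 ∪ ctxSet K (qbBodies W o₁ oA oB bA bB q baseV) with hA5
  have l6 := tbmCv2 hG (qv.mono (hΓ (X := A5))) (holds_ctxSet fun θ hθ => Or.inr (Or.inr hθ))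
  set A6 := A5 ∪ {ctx K (eqv ((mB W o₁ oA oB bA bB q baseV).T.ge (W + 3) (W + 3)) ((tD W o₁ oA oB bA bB q baseV).S₃.ge (W + 3) (W + 3)))} with hA6
  have l7 : G.Yields (Γ ∪ A6) {ctx K (var ((tD W o₁ oA oB bA bB q baseV).S₃.ge (W + 3) (W + 3)))} (K.size + 2) := by
    have h := Yields.single (Logic.infer hG.logic 7 (by decide) (S := Γ ∪ A6)
      (FregeSystem.sub [K, var ((mB W o₁ oA oB bA bB q baseV).T.ge (W + 3) (W + 3)), var ((tD W o₁ oA oB bA bB q baseV).S₃.ge (W + 3) (W + 3))]) (θ := ctx K (var ((tD W o₁ oA oB bA bB q baseV).S₃.ge (W + 3) (W + 3)))) rfl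
      (FregeSystem.prems_cons (Or.inr (Or.inl (Or.inl (Or.inr rfl)))) (FregeSystem.prems_cons (Or.inr (Or.inr rfl)) FregeSystem.prems_nil)))
    exact h.mono_size (by simp [ctx, size])
  set A7 := A6 ∪ {ctx K (var ((tD W o₁ oA oB bA bB q baseV).S₃.ge (W + 3) (W + 3)))} with hA7
  have l8 : G.Yields (Γ ∪ A7) ({ctx K (biimp (var ((tD W o₁ oA oB bA bB q baseV).S₁.ge (W + 3) (W + 3))) (disj (var (sel W oA)) (var (sel W oB))))} ∪
      {ctx K (biimp (var ((tD W o₁ oA oB bA bB q baseV).S₃.ge (W + 3) (W + 3))) (conj (var (sel W oA)) (var (sel W oB))))}) ((K.size + 14) + (K.size + 14)) := by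
    refine Yields.union ?_ ?_
    · have h := Yields.single (Assoc.infer hG 3 (by decide) (S := Γ ∪ A7)
        (FregeSystem.sub [K, var ((tD W o₁ oA oB bA bB q baseV).S₁.ge (W + 3) (W + 3)), var (sel W oA), var (sel W oB)])
        (θ := ctx K (biimp (var ((tD W o₁ oA oB bA bB q baseV).S₁.ge (W + 3) (W + 3))) (disj (var (sel W oA)) (var (sel W oB))))) rfl
        (FregeSystem.prems_cons (Or.inr (Or.inl (Or.inl (Or.inl (Or.inl (Or.inl (Or.inr rfl))))))) (FregeSystem.prems_cons (Or.inl hselA)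
          FregeSystem.prems_nil)))
      exact h.mono_size (by simp [ctx, size, FregeSystem.size_biimp])
    · have h := Yields.single (Assoc.infer hG 6 (by decide) (S := Γ ∪ A7)
        (FregeSystem.sub [K, var ((tD W o₁ oA oB bA bB q baseV).S₃.ge (W + 3) (W + 3)), var (sel W oA), var (sel W oB)])
        (θ := ctx K (biimp (var ((tD W o₁ oA oB bA bB q baseV).S₃.ge (W + 3) (W + 3))) (conj (var (sel W oA)) (var (sel W oB))))) rfl
        (FregeSystem.prems_cons (Or.inr (Or.inr rfl)) (FregeSystem.prems_cons (Or.inl hselA) (FregeSystem.prems_cons (Or.inl hselB)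
          FregeSystem.prems_nil))))
      exact h.mono_size (by simp [ctx, size, FregeSystem.size_biimp])
  have h := ((((((l1.trans l2).trans l3).trans l4).trans l5).trans l6).trans l7).trans l8
  refine (h.mono_right ?_).mono_size (by nlinarith [Nat.zero_le W, Nat.zero_le K.size])
  rintro θ ⟨L, hL, rfl⟩
  simp only [concl, List.mem_cons, List.not_mem_nil, or_false] at hL
  rcases hL with rfl | rfl
  · exact Or.inr (Or.inl rfl)
  · exact Or.inr (Or.inr rfl)

/-- **Leaf `G_A ∧ ¬G_B`.** [cite: CookReckhow1979, §2] [cite: Krajicek1995, §9.2] -/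
theorem leafTF (hG : ARulesOK G) (qv : QuotViews W o₁ oA oB bA bB q baseV K Γ) (hV : (Vv W o₁ oA oB bA bB baseV).Avail K Γ false (W + 2))
    (hPB : (P W oB bB).Avail K Γ false (W + 1)) (hmA : ∀ i < W, ctx K (biimp (var (M bA i)) (conj (var (sel W oA)) (var (nv W oA i)))) ∈ Γ)
    (hmB : ∀ i < W, ctx K (biimp (var (M bB i)) (conj (var (sel W oB)) (var (nv W oB i)))) ∈ Γ) (hnA : ∀ i < W, nv W oA i = nv W o₁ i)
    (hfz : ctx K (neg (var (f W o₁))) ∈ Γ) (hfA : ctx K (neg (var (f W oA))) ∈ Γ) (hfB : ctx K (neg (var (f W oB))) ∈ Γ)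
    (hPc : ctx K (neg (var ((P W oB bB).c (W + 1)))) ∈ Γ) (hclr : ctx K (neg (var ((mA W o₁ oB bB q).S.ge (W + 1) (W + 1)))) ∈ Γ)
    (hselA : ctx K (var (sel W oA)) ∈ Γ) (hnselB : ctx K (neg (var (sel W oB))) ∈ Γ) :
    G.Yields Γ (ctxSet K (concl W o₁ oA oB bA bB q baseV)) ((22 * W + 100) * (K.size + 60)) := by
  have hΓ : ∀ {X : Set (PropForm ℕ)}, Γ ⊆ Γ ∪ X := fun {X} => Set.subset_union_left
  have l1 := (masksOn hG hmA hnA hselA).union (masksOff hG hmB hnselB)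
  set A1 := ctxSet K (eqW (M bA) (nv W o₁) W) ∪ ctxSet K ((List.range W).map fun i => neg (var (M bB i))) with hA1
  have hMA : ∀ {X : Set (PropForm ℕ)}, A1 ⊆ X → Holds K (Γ ∪ X) (eqW (M bA) (nv W o₁) W) := fun hX =>
    holds_ctxSet fun θ hθ => Or.inr (hX (Or.inl hθ))
  have hMB : ∀ {X : Set (PropForm ℕ)}, A1 ⊆ X → Holds K (Γ ∪ X) ((List.range W).map fun i => neg (var (M bB i))) := fun hX =>
    holds_ctxSet fun θ hθ => Or.inr (hX (Or.inr hθ))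
  have l2 := geOne hG (qv.mono hΓ) (hV.mono hΓ) (hMA subset_rfl) (hΓ hfz) (hΓ hfA)
  set A2 := A1 ∪ {ctx K (var ((tD W o₁ oA oB bA bB q baseV).S₁.ge (W + 3) (W + 3)))} with hA2
  have l3 := clFalse hG (qv.mono (hΓ (X := A2))) (hPB.mono hΓ) (hMB fun θ hθ => Or.inl hθ) (hΓ hfz) (hΓ hfB) (hΓ hPc) (hΓ hclr)
  set A3 := A2 ∪ ({χ | χ ∈ Adder.zeroLines (P W oB bB) K (W + 1)} ∪ {ctx K (neg (var ((mB W o₁ oA oB bA bB q baseV).S.ge (W + 2) (W + 2))))}) with hA3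
  have l4 := monoNeg hG (qv.mono (hΓ (X := A3))) (hV.mono hΓ) (Or.inr (Or.inr (Or.inr rfl)))
  set A4 := A3 ∪ {ctx K (neg (var ((mB W o₁ oA oB bA bB q baseV).T.ge (W + 3) (W + 3))))} with hA4
  have l5 := qbWord hG (qv.mono (hΓ (X := A4))) (hMA fun θ hθ => Or.inl (Or.inl (Or.inl hθ))) (hΓ hfz) (hΓ hfA)
  set A5 := A4 ∪ ctxSet K (qbBodies W o₁ oA oB bA bB q baseV) with hA5
  have l6 := tbmCv2 hG (qv.mono (hΓ (X := A5))) (holds_ctxSet fun θ hθ => Or.inr (Or.inr hθ))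
  set A6 := A5 ∪ {ctx K (eqv ((mB W o₁ oA oB bA bB q baseV).T.ge (W + 3) (W + 3)) ((tD W o₁ oA oB bA bB q baseV).S₃.ge (W + 3) (W + 3)))} with hA6
  have l7 : G.Yields (Γ ∪ A6) {ctx K (neg (var ((tD W o₁ oA oB bA bB q baseV).S₃.ge (W + 3) (W + 3))))} (K.size + 3) := by
    have h := Yields.single (Logic.infer hG.logic 8 (by decide) (S := Γ ∪ A6)
      (FregeSystem.sub [K, var ((mB W o₁ oA oB bA bB q baseV).T.ge (W + 3) (W + 3)), var ((tD W o₁ oA oB bA bB q baseV).S₃.ge (W + 3) (W + 3))]) (θ := ctx K (neg (var ((tD W o₁ oA oB bA bB q baseV).S₃.ge (W + 3) (W + 3))))) rfl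
      (FregeSystem.prems_cons (Or.inr (Or.inl (Or.inl (Or.inr rfl)))) (FregeSystem.prems_cons (Or.inr (Or.inr rfl)) FregeSystem.prems_nil)))
    exact h.mono_size (by simp [ctx, size])
  set A7 := A6 ∪ {ctx K (neg (var ((tD W o₁ oA oB bA bB q baseV).S₃.ge (W + 3) (W + 3))))} with hA7
  have l8 : G.Yields (Γ ∪ A7) ({ctx K (biimp (var ((tD W o₁ oA oB bA bB q baseV).S₁.ge (W + 3) (W + 3))) (disj (var (sel W oA)) (var (sel W oB))))} ∪
      {ctx K (biimp (var ((tD W o₁ oA oB bA bB q baseV).S₃.ge (W + 3) (W + 3))) (conj (var (sel W oA)) (var (sel W oB))))}) ((K.size + 14) + (K.size + 14)) := by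
    refine Yields.union ?_ ?_
    · have h := Yields.single (Assoc.infer hG 3 (by decide) (S := Γ ∪ A7)
        (FregeSystem.sub [K, var ((tD W o₁ oA oB bA bB q baseV).S₁.ge (W + 3) (W + 3)), var (sel W oA), var (sel W oB)])
        (θ := ctx K (biimp (var ((tD W o₁ oA oB bA bB q baseV).S₁.ge (W + 3) (W + 3))) (disj (var (sel W oA)) (var (sel W oB))))) rfl
        (FregeSystem.prems_cons (Or.inr (Or.inl (Or.inl (Or.inl (Or.inl (Or.inl (Or.inr rfl))))))) (FregeSystem.prems_cons (Or.inl hselA)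
          FregeSystem.prems_nil)))
      exact h.mono_size (by simp [ctx, size, FregeSystem.size_biimp])
    · have h := Yields.single (Assoc.infer hG 8 (by decide) (S := Γ ∪ A7)
        (FregeSystem.sub [K, var ((tD W o₁ oA oB bA bB q baseV).S₃.ge (W + 3) (W + 3)), var (sel W oA), var (sel W oB)])
        (θ := ctx K (biimp (var ((tD W o₁ oA oB bA bB q baseV).S₃.ge (W + 3) (W + 3))) (conj (var (sel W oA)) (var (sel W oB))))) rfl
        (FregeSystem.prems_cons (Or.inr (Or.inr rfl)) (FregeSystem.prems_cons (Or.inl hnselB) FregeSystem.prems_nil)))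
      exact h.mono_size (by simp [ctx, size, FregeSystem.size_biimp])
  have h := ((((((l1.trans l2).trans l3).trans l4).trans l5).trans l6).trans l7).trans l8
  refine (h.mono_right ?_).mono_size (by nlinarith [Nat.zero_le W, Nat.zero_le K.size])
  rintro θ ⟨L, hL, rfl⟩
  simp only [concl, List.mem_cons, List.not_mem_nil, or_false] at hL
  rcases hL with rfl | rfl
  · exact Or.inr (Or.inl rfl)
  · exact Or.inr (Or.inr rfl)

/-- **The zero law for `V` when the masks of `oA` are off**: `s(V) = extOut P_B`, no carries.
[cite: CookReckhow1979, §2] -/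
theorem zeroV (hG : ARulesOK G) (hV : (Vv W o₁ oA oB bA bB baseV).Avail K Γ false (W + 2)) (hmA : Holds K Γ ((List.range W).map fun i => neg (var (M bA i))))
    (hfz : ctx K (neg (var (f W o₁))) ∈ Γ) (hfA : ctx K (neg (var (f W oA))) ∈ Γ) :
    G.Yields Γ {χ | χ ∈ Adder.zeroLines (Vv W o₁ oA oB bA bB baseV) K (W + 2)} ((2 * (W + 2) + 1) * (K.size + 10)) := by
  refine Yields.of_isBlock (Adder.isBlock_zeroLines hG.adderLaw (Vv W o₁ oA oB bA bB baseV) hV fun i hi => ?_) subset_rfl (Adder.proofSize_zeroLines _ _ _)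
  show ctx K (neg (var (NAe W o₁ oA bA i))) ∈ Γ
  by_cases h0 : i < W
  · rw [NAe, Adder.zext_lt _ _ (by omega), NA, Adder.zext_lt _ _ h0]; exact hmA _ (List.mem_map.2 ⟨i, List.mem_range.2 h0, rfl⟩)
  · rcases Nat.lt_succ_iff_lt_or_eq.1 hi with hi' | hi'
    · rw [show i = W by omega, NAe, Adder.zext_lt _ _ (Nat.lt_succ_self W), NA, Adder.zext_top]; exact hfA
    · rw [hi', NAe, Adder.zext_top]; exact hfz

/-- **Leaf `¬G_A ∧ G_B`.** [cite: CookReckhow1979, §2] [cite: Krajicek1995, §9.2] -/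
theorem leafFT (hG : ARulesOK G) (qv : QuotViews W o₁ oA oB bA bB q baseV K Γ) (hV : (Vv W o₁ oA oB bA bB baseV).Avail K Γ false (W + 2))
    (hPB : (P W oB bB).Avail K Γ false (W + 1)) (hmA : ∀ i < W, ctx K (biimp (var (M bA i)) (conj (var (sel W oA)) (var (nv W oA i)))) ∈ Γ)
    (hmB : ∀ i < W, ctx K (biimp (var (M bB i)) (conj (var (sel W oB)) (var (nv W oB i)))) ∈ Γ) (hnB : ∀ i < W, nv W oB i = nv W o₁ i)
    (hfz : ctx K (neg (var (f W o₁))) ∈ Γ) (hfA : ctx K (neg (var (f W oA))) ∈ Γ) (hfB : ctx K (neg (var (f W oB))) ∈ Γ)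
    (hclr : ctx K (neg (var ((mA W o₁ oB bB q).S.ge (W + 1) (W + 1)))) ∈ Γ) (hnselA : ctx K (neg (var (sel W oA))) ∈ Γ) (hselB : ctx K (var (sel W oB)) ∈ Γ) :
    G.Yields Γ (ctxSet K (concl W o₁ oA oB bA bB q baseV)) ((30 * W + 120) * (K.size + 60)) := by
  have hΓ : ∀ {X : Set (PropForm ℕ)}, Γ ⊆ Γ ∪ X := fun {X} => Set.subset_union_left
  -- f1: masks
  have f1 := (masksOff hG hmA hnselA).union (masksOn hG hmB hnB hselB)
  set A1 := ctxSet K ((List.range W).map fun i => neg (var (M bA i))) ∪ ctxSet K (eqW (M bB) (nv W o₁) W) with hA1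
  have hMA : ∀ {X : Set (PropForm ℕ)}, A1 ⊆ X → Holds K (Γ ∪ X) ((List.range W).map fun i => neg (var (M bA i))) := fun hX =>
    holds_ctxSet fun θ hθ => Or.inr (hX (Or.inl hθ))
  have hMB : ∀ {X : Set (PropForm ℕ)}, A1 ⊆ X → Holds K (Γ ∪ X) (eqW (M bB) (nv W o₁) W) := fun hX =>
    holds_ctxSet fun θ hθ => Or.inr (hX (Or.inr hθ))
  -- f2: the zero law for `V`
  have f2 := zeroV hG (hV.mono hΓ) (hMA subset_rfl) (hΓ hfz) (hΓ hfA)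
  set A2 := A1 ∪ {χ | χ ∈ Adder.zeroLines (Vv W o₁ oA oB bA bB baseV) K (W + 2)} with hA2
  have mVs : ∀ {X : Set (PropForm ℕ)}, A2 ⊆ X → ∀ i < W + 2, ctx K (eqv ((Vv W o₁ oA oB bA bB baseV).s i) (Adder.extOut (P W oB bB) (W + 1) i)) ∈ Γ ∪ X :=
    fun hX i hi => Or.inr (hX (Or.inr (Adder.sum_mem_zeroLines hi)))
  have mVc : ∀ {X : Set (PropForm ℕ)}, A2 ⊆ X → ∀ i ≤ W + 2, ctx K (neg (var ((Vv W o₁ oA oB bA bB baseV).c i))) ∈ Γ ∪ X :=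
    fun hX i hi => Or.inr (hX (Or.inr (Adder.carry_mem_zeroLines hi)))
  -- f3: masks of `oB` reversed, `fz ↔ fB`, `fz ↔ fz`
  have f3 := ((Yields.eqW_symm hG.logic (hMB (X := A2) fun θ hθ => Or.inl hθ)).union (eqvFF hG (x := f W o₁) (y := f W oB) (hΓ hfz) (hΓ hfB))).union
    (eqvFF hG (x := f W o₁) (y := f W o₁) (hΓ hfz) (hΓ hfz))
  set A3 := A2 ∪ ((ctxSet K (eqW (nv W o₁) (M bB) W) ∪ {ctx K (eqv (f W o₁) (f W oB))}) ∪ {ctx K (eqv (f W o₁) (f W o₁))}) with hA3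
  -- f4: `P_B ≥ zext N_B`
  have f4 : G.Yields (Γ ∪ A3) {χ | χ ∈ (gP W o₁ oB bB q).lines K} ((W + 1 + 2) * (K.size + 12)) :=
    Yields.of_isBlock (Sub.GeData.isBlock_lines hG.order (gP W o₁ oB bB q) (hPB.mono hΓ) (qv.tgp.mono hΓ) (hΓ hfz)) subset_rfl (Sub.GeData.proofSize_lines _ _)
  set A4 := A3 ∪ {χ | χ ∈ (gP W o₁ oB bB q).lines K} with hA4
  -- f5: link `CV1` with `TgP` on `W+2` positions
  have f5 : G.Yields (Γ ∪ A4) (ctxSet K (linkLines (tD W o₁ oA oB bA bB q baseV).S₁ (gP W o₁ oB bB q).T (W + 3) (W + 2) (W + 2))) ((3 * (W + 2) + 1) * (K.size + 10)) := by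
    refine linkLow hG.toRulesOK (tD W o₁ oA oB bA bB q baseV).S₁ (gP W o₁ oB bB q).T (qv.cv1.mono hΓ) (qv.tgp.mono hΓ) (by omega) le_rfl (fun i hi => ?_) fun i hi => ?_
    · show ctx K (eqv (Adder.extOut (Vv W o₁ oA oB bA bB baseV) (W + 2) i) (Adder.extOut (P W oB bB) (W + 1) i)) ∈ Γ ∪ A4
      rw [Adder.extOut_lt _ hi]; exact mVs (fun θ hθ => Or.inl (Or.inl hθ)) i hi
    · show ctx K (eqv (next W o₁ i) (Adder.zext (NB W oB bB) (f W o₁) (W + 1) i)) ∈ Γ ∪ A4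
      by_cases h0 : i < W
      · rw [next, Adder.zext_lt _ _ h0, Adder.zext_lt _ _ (by omega), NB, Adder.zext_lt _ _ h0]
        exact Or.inr (Or.inl (Or.inr (Or.inl (Or.inl (mem_ctxSet (mem_eqW (b := M bB) h0))))))
      · rw [next, zext_ge _ _ (not_lt.1 h0)]
        rcases Nat.lt_succ_iff_lt_or_eq.1 hi with hi' | hi'
        · rw [show i = W by omega, Adder.zext_lt _ _ (Nat.lt_succ_self W), NB, Adder.zext_top]; exact Or.inr (Or.inl (Or.inr (Or.inl (Or.inr rfl))))
        · rw [hi', Adder.zext_top]; exact Or.inr (Or.inl (Or.inr (Or.inr rfl)))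
  set A5 := A4 ∪ ctxSet K (linkLines (tD W o₁ oA oB bA bB q baseV).S₁ (gP W o₁ oB bB q).T (W + 3) (W + 2) (W + 2)) with hA5
  -- f6: `ge_{W+2}(TgP) ↔ ge_{W+2}(CV1)`, hence `ge_{W+2}(CV1)`, lifted to `G₁`
  have f6 := eqvSymm hG (K := K) (Γ := Γ ∪ A5) (x := (tD W o₁ oA oB bA bB q baseV).S₁.ge (W + 3) (W + 2)) (y := (gP W o₁ oB bB q).T.ge (W + 2) (W + 2))
    (Or.inr (Or.inr (mem_ctxSet (ge_mem_linkLines _ _ _ _ _))))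
  set A6 := A5 ∪ {ctx K (eqv ((gP W o₁ oB bB q).T.ge (W + 2) (W + 2)) ((tD W o₁ oA oB bA bB q baseV).S₁.ge (W + 3) (W + 2)))} with hA6
  have f7 : G.Yields (Γ ∪ A6) {ctx K (var ((tD W o₁ oA oB bA bB q baseV).S₁.ge (W + 3) (W + 2)))} (K.size + 2) := by
    have h := Yields.single (Logic.infer hG.logic 7 (by decide) (S := Γ ∪ A6)
      (FregeSystem.sub [K, var ((gP W o₁ oB bB q).T.ge (W + 2) (W + 2)), var ((tD W o₁ oA oB bA bB q baseV).S₁.ge (W + 3) (W + 2))]) (θ := ctx K (var ((tD W o₁ oA oB bA bB q baseV).S₁.ge (W + 3) (W + 2)))) rfl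
      (FregeSystem.prems_cons (Or.inr (Or.inl (Or.inl (Or.inr ((gP W o₁ oB bB q).mem_lines K)))))
        (FregeSystem.prems_cons (Or.inr (Or.inr rfl)) FregeSystem.prems_nil)))
    exact h.mono_size (by simp [ctx, size])
  set A7 := A6 ∪ {ctx K (var ((tD W o₁ oA oB bA bB q baseV).S₁.ge (W + 3) (W + 2)))} with hA7
  have f8 : G.Yields (Γ ∪ A7) (ctxSet K (liftList (tD W o₁ oA oB bA bB q baseV).S₁ (W + 3) (W + 2) true 1)) (3 * 1 * (K.size + 9 + 1)) := by
    refine lift hG (tD W o₁ oA oB bA bB q baseV).S₁ true (qv.cv1.mono hΓ) le_rfl (Or.inr (Or.inr rfl)) (fun j hj hj' => ?_) fun j hj hj' => ?_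
    · show ctx K (neg (var (Adder.extOut (Vv W o₁ oA oB bA bB baseV) (W + 2) j))) ∈ Γ ∪ A7
      rw [show j = W + 2 by omega, Adder.extOut_top]; exact mVc (fun θ hθ => Or.inl (Or.inl (Or.inl (Or.inl (Or.inl hθ))))) _ le_rfl
    · show ctx K (neg (var (next W o₁ j))) ∈ Γ ∪ A7
      rw [next, zext_ge _ _ (by omega)]; exact Or.inl hfz
  set A8 := A7 ∪ ctxSet K (liftList (tD W o₁ oA oB bA bB q baseV).S₁ (W + 3) (W + 2) true 1) with hA8
  have mG₁ : ctx K (var ((tD W o₁ oA oB bA bB q baseV).S₁.ge (W + 3) (W + 3))) ∈ Γ ∪ A8 := Or.inr (Or.inr (mem_ctxSet (lit_mem_liftList (tD W o₁ oA oB bA bB q baseV).S₁ (W + 3) (W + 2) true Nat.one_pos)))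
  -- f9: `P_B < QA` by monotonicity from `zext res < n`
  have f9 : G.Yields (Γ ∪ A8) {χ | χ ∈ (mA W o₁ oB bB q).lines K ++ [ctx K (neg (var ((mA W o₁ oB bB q).T.ge (W + 1 + 1) (W + 1 + 1))))]} ((W + 1 + 2) * (K.size + 55)) :=
    Yields.of_isBlock (Sub.MonoData.isBlock_mono hG.order (mA W o₁ oB bB q) (qv.clr.mono hΓ) (hPB.mono hΓ) (qv.qa.mono hΓ) (qv.tam.mono hΓ) (hΓ hclr))
      subset_rfl (Sub.MonoData.proofSize_mono _ _ _)
  set A9 := A8 ∪ {χ | χ ∈ (mA W o₁ oB bB q).lines K ++ [ctx K (neg (var ((mA W o₁ oB bB q).T.ge (W + 1 + 1) (W + 1 + 1))))]} with hA9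
  -- f10: `QA = 2n`
  have f10 := qaWord hG (qv.mono (hΓ (X := A9))) (hMB fun θ hθ => Or.inl (Or.inl (Or.inl (Or.inl (Or.inl (Or.inl (Or.inl (Or.inl hθ)))))))) (hΓ hfz) (hΓ hfB)
  set A10 := A9 ∪ ctxSet K (qaBodies W o₁ oB bB q) with hA10
  -- f11: link `CV2` with `TAm` on `W+2` positions
  have f11 : G.Yields (Γ ∪ A10) (ctxSet K (linkLines (tD W o₁ oA oB bA bB q baseV).S₃ (mA W o₁ oB bB q).T (W + 3) (W + 2) (W + 2))) ((3 * (W + 2) + 1) * (K.size + 10)) := by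
    refine linkLow hG.toRulesOK (tD W o₁ oA oB bA bB q baseV).S₃ (mA W o₁ oB bB q).T (qv.cv2.mono hΓ) (qv.tam.mono hΓ) (by omega) le_rfl (fun i hi => ?_) fun i hi =>
      holds_qa (holds_ctxSet fun θ hθ => Or.inr (Or.inr hθ)) i hi
    show ctx K (eqv (Adder.extOut (Vv W o₁ oA oB bA bB baseV) (W + 2) i) (Adder.extOut (P W oB bB) (W + 1) i)) ∈ Γ ∪ A10
    rw [Adder.extOut_lt _ hi]; exact mVs (fun θ hθ => Or.inl (Or.inl (Or.inl (Or.inl (Or.inl (Or.inl (Or.inl (Or.inl hθ)))))))) i hi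
  set A11 := A10 ∪ ctxSet K (linkLines (tD W o₁ oA oB bA bB q baseV).S₃ (mA W o₁ oB bB q).T (W + 3) (W + 2) (W + 2)) with hA11
  -- f12: `¬ge_{W+2}(CV2)`, lifted to `¬G₂`
  have f12 : G.Yields (Γ ∪ A11) {ctx K (neg (var ((tD W o₁ oA oB bA bB q baseV).S₃.ge (W + 3) (W + 2))))} (2 * (K.size + 10)) :=
    DomAux.negTransport hG.toRulesOK (Or.inr (Or.inl (Or.inl (Or.inr (List.mem_append_right _ (List.mem_singleton_self _))))))
      (Or.inr (Or.inr (mem_ctxSet (ge_mem_linkLines _ _ _ _ _))))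
  set A12 := A11 ∪ {ctx K (neg (var ((tD W o₁ oA oB bA bB q baseV).S₃.ge (W + 3) (W + 2))))} with hA12
  have f13 : G.Yields (Γ ∪ A12) (ctxSet K (liftList (tD W o₁ oA oB bA bB q baseV).S₃ (W + 3) (W + 2) false 1)) (3 * 1 * (K.size + 9 + 1)) := by
    refine lift hG (tD W o₁ oA oB bA bB q baseV).S₃ false (qv.cv2.mono hΓ) le_rfl (Or.inr (Or.inr rfl)) (fun j hj hj' => ?_) fun j hj hj' => ?_
    · show ctx K (neg (var (Adder.extOut (Vv W o₁ oA oB bA bB baseV) (W + 2) j))) ∈ Γ ∪ A12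
      rw [show j = W + 2 by omega, Adder.extOut_top]
      exact mVc (fun θ hθ => Or.inl (Or.inl (Or.inl (Or.inl (Or.inl (Or.inl (Or.inl (Or.inl (Or.inl (Or.inl hθ)))))))))) _ le_rfl
    · show ctx K (neg (var (N2e W o₁ q j))) ∈ Γ ∪ A12
      rw [N2e, zext_ge _ _ (by omega)]; exact Or.inl hfz
  set A13 := A12 ∪ ctxSet K (liftList (tD W o₁ oA oB bA bB q baseV).S₃ (W + 3) (W + 2) false 1) with hA13
  have mG₂ : ctx K (neg (var ((tD W o₁ oA oB bA bB q baseV).S₃.ge (W + 3) (W + 3)))) ∈ Γ ∪ A13 :=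
    Or.inr (Or.inr (mem_ctxSet (lit_mem_liftList (tD W o₁ oA oB bA bB q baseV).S₃ (W + 3) (W + 2) false Nat.one_pos)))
  -- f14: the conclusions
  have f14 : G.Yields (Γ ∪ A13) ({ctx K (biimp (var ((tD W o₁ oA oB bA bB q baseV).S₁.ge (W + 3) (W + 3))) (disj (var (sel W oA)) (var (sel W oB))))} ∪
      {ctx K (biimp (var ((tD W o₁ oA oB bA bB q baseV).S₃.ge (W + 3) (W + 3))) (conj (var (sel W oA)) (var (sel W oB))))}) ((K.size + 14) + (K.size + 14)) := by
    refine Yields.union ?_ ?_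
    · have h := Yields.single (Assoc.infer hG 4 (by decide) (S := Γ ∪ A13)
        (FregeSystem.sub [K, var ((tD W o₁ oA oB bA bB q baseV).S₁.ge (W + 3) (W + 3)), var (sel W oA), var (sel W oB)])
        (θ := ctx K (biimp (var ((tD W o₁ oA oB bA bB q baseV).S₁.ge (W + 3) (W + 3))) (disj (var (sel W oA)) (var (sel W oB))))) rfl
        (FregeSystem.prems_cons (mG₁.elim Or.inl fun h => Or.inr (Or.inl (Or.inl (Or.inl (Or.inl (Or.inl h))))))
          (FregeSystem.prems_cons (Or.inl hselB) FregeSystem.prems_nil)))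
      exact h.mono_size (by simp [ctx, size, FregeSystem.size_biimp])
    · have h := Yields.single (Assoc.infer hG 7 (by decide) (S := Γ ∪ A13)
        (FregeSystem.sub [K, var ((tD W o₁ oA oB bA bB q baseV).S₃.ge (W + 3) (W + 3)), var (sel W oA), var (sel W oB)])
        (θ := ctx K (biimp (var ((tD W o₁ oA oB bA bB q baseV).S₃.ge (W + 3) (W + 3))) (conj (var (sel W oA)) (var (sel W oB))))) rfl
        (FregeSystem.prems_cons mG₂ (FregeSystem.prems_cons (Or.inl hnselA) FregeSystem.prems_nil)))
      exact h.mono_size (by simp [ctx, size, FregeSystem.size_biimp])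
  have h := ((((((((((((f1.trans f2).trans f3).trans f4).trans f5).trans f6).trans f7).trans f8).trans f9).trans f10).trans f11).trans f12).trans
    f13).trans f14
  refine (h.mono_right ?_).mono_size (by nlinarith [Nat.zero_le W, Nat.zero_le K.size])
  rintro θ ⟨L, hL, rfl⟩
  simp only [concl, List.mem_cons, List.not_mem_nil, or_false] at hL
  rcases hL with rfl | rfl
  · exact Or.inr (Or.inl rfl)
  · exact Or.inr (Or.inr rfl)

/-- **Leaf `¬G_A ∧ ¬G_B`.** [cite: CookReckhow1979, §2] [cite: Krajicek1995, §9.2] -/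
theorem leafFF (hG : ARulesOK G) (qv : QuotViews W o₁ oA oB bA bB q baseV K Γ) (hV : (Vv W o₁ oA oB bA bB baseV).Avail K Γ false (W + 2))
    (hPB : (P W oB bB).Avail K Γ false (W + 1)) (hmA : ∀ i < W, ctx K (biimp (var (M bA i)) (conj (var (sel W oA)) (var (nv W oA i)))) ∈ Γ)
    (hmB : ∀ i < W, ctx K (biimp (var (M bB i)) (conj (var (sel W oB)) (var (nv W oB i)))) ∈ Γ)
    (hfz : ctx K (neg (var (f W o₁))) ∈ Γ) (hfA : ctx K (neg (var (f W oA))) ∈ Γ) (hfB : ctx K (neg (var (f W oB))) ∈ Γ)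
    (hPc : ctx K (neg (var ((P W oB bB).c (W + 1)))) ∈ Γ) (hclr : ctx K (neg (var ((mA W o₁ oB bB q).S.ge (W + 1) (W + 1)))) ∈ Γ)
    (hn2n : ctx K (neg (var ((tD W o₁ oA oB bA bB q baseV).S₂.ge (W + 3) (W + 3)))) ∈ Γ) (hnselA : ctx K (neg (var (sel W oA))) ∈ Γ)
    (hnselB : ctx K (neg (var (sel W oB))) ∈ Γ) :
    G.Yields Γ (ctxSet K (concl W o₁ oA oB bA bB q baseV)) ((20 * W + 100) * (K.size + 60)) := by
  have hΓ : ∀ {X : Set (PropForm ℕ)}, Γ ⊆ Γ ∪ X := fun {X} => Set.subset_union_left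
  -- e1: masks off
  have e1 := (masksOff hG hmA hnselA).union (masksOff hG hmB hnselB)
  set A1 := ctxSet K ((List.range W).map fun i => neg (var (M bA i))) ∪ ctxSet K ((List.range W).map fun i => neg (var (M bB i))) with hA1
  -- e2: the zero laws for `P_B` and `V`
  have e2 : G.Yields (Γ ∪ A1) ({χ | χ ∈ Adder.zeroLines (P W oB bB) K (W + 1)} ∪ {χ | χ ∈ Adder.zeroLines (Vv W o₁ oA oB bA bB baseV) K (W + 2)})
      (((2 * (W + 1) + 1) * (K.size + 10)) + ((2 * (W + 2) + 1) * (K.size + 10))) := by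
    refine Yields.union (Yields.of_isBlock (Adder.isBlock_zeroLines hG.adderLaw (P W oB bB) (hPB.mono hΓ) fun i hi => ?_) subset_rfl
      (Adder.proofSize_zeroLines _ _ _)) (zeroV hG (hV.mono hΓ) (holds_ctxSet fun θ hθ => Or.inr (Or.inl hθ)) (hΓ hfz) (hΓ hfA))
    show ctx K (neg (var (Adder.zext (M bB) (f W oB) W i))) ∈ Γ ∪ A1
    rcases Nat.lt_succ_iff_lt_or_eq.1 hi with hi' | hi'
    · rw [Adder.zext_lt _ _ hi']; exact Or.inr (Or.inr (mem_ctxSet (List.mem_map.2 ⟨i, List.mem_range.2 hi', rfl⟩)))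
    · rw [hi', Adder.zext_top]; exact Or.inl hfB
  set A2 := A1 ∪ ({χ | χ ∈ Adder.zeroLines (P W oB bB) K (W + 1)} ∪ {χ | χ ∈ Adder.zeroLines (Vv W o₁ oA oB bA bB baseV) K (W + 2)}) with hA2
  have mPs : ∀ i < W + 1, ctx K (eqv ((P W oB bB).s i) (Adder.zext (u W oB) (f W oB) W i)) ∈ A2 := fun i hi => Or.inr (Or.inl (Adder.sum_mem_zeroLines hi))
  have mVs : ∀ i < W + 2, ctx K (eqv ((Vv W o₁ oA oB bA bB baseV).s i) (Adder.extOut (P W oB bB) (W + 1) i)) ∈ A2 := fun i hi => Or.inr (Or.inr (Adder.sum_mem_zeroLines hi))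
  have mVc : ∀ i ≤ W + 2, ctx K (neg (var ((Vv W o₁ oA oB bA bB baseV).c i))) ∈ A2 := fun i hi => Or.inr (Or.inr (Adder.carry_mem_zeroLines hi))
  -- e3: `¬s_W(P_B)`, then `¬s_W(V)` and `¬s_{W+1}(V)`
  have e3 : G.Yields (Γ ∪ A2) {ctx K (neg (var ((P W oB bB).s W)))} (2 * (K.size + 10)) :=
    DomAux.negTransport hG.toRulesOK (x := Adder.zext (u W oB) (f W oB) W W) (by rw [Adder.zext_top]; exact Or.inl hfB) (Or.inr (mPs W (Nat.lt_succ_self W)))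
  set A3 := A2 ∪ {ctx K (neg (var ((P W oB bB).s W)))} with hA3
  have e4 := (DomAux.negTransport hG.toRulesOK (K := K) (Γ := Γ ∪ A3) (x := Adder.extOut (P W oB bB) (W + 1) W) (y := (Vv W o₁ oA oB bA bB baseV).s W)
    (by rw [Adder.extOut_lt _ (Nat.lt_succ_self W)]; exact Or.inr (Or.inr rfl)) (Or.inr (Or.inl (mVs W (by omega))))).union
    (DomAux.negTransport hG.toRulesOK (K := K) (Γ := Γ ∪ A3) (x := Adder.extOut (P W oB bB) (W + 1) (W + 1)) (y := (Vv W o₁ oA oB bA bB baseV).s (W + 1))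
    (by rw [Adder.extOut_top]; exact Or.inl hPc) (Or.inr (Or.inl (mVs (W + 1) (by omega)))))
  set A4 := A3 ∪ ({ctx K (neg (var ((Vv W o₁ oA oB bA bB baseV).s W)))} ∪ {ctx K (neg (var ((Vv W o₁ oA oB bA bB baseV).s (W + 1))))}) with hA4
  -- e5: `s_i(V) ↔ (zext res)_i` for `i ≤ W`, and reflexivity of `next`
  have e5 : G.Yields (Γ ∪ A4) (ctxSet K (eqW (Vv W o₁ oA oB bA bB baseV).s (Adder.zext (u W oB) (f W oB) W) (W + 1))) ((W + 1) * (K.size + 9 + 1)) :=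
    Yields.ctx_range (fun i hi => Or.inr (Logic.infer hG.logic 6 (by decide)
      (FregeSystem.sub [K, var ((Vv W o₁ oA oB bA bB baseV).s i), var (Adder.extOut (P W oB bB) (W + 1) i), var (Adder.zext (u W oB) (f W oB) W i)]) rfl
      (FregeSystem.prems_cons (Or.inr (Or.inl (Or.inl (mVs i (by omega)))))
        (FregeSystem.prems_cons (by have h := mPs i hi; rw [← Adder.extOut_lt (P W oB bB) hi] at h; exact Or.inr (Or.inl (Or.inl h)))
        FregeSystem.prems_nil)))) fun _ _ => (size_eqv _ _).le
  set A5 := A4 ∪ ctxSet K (eqW (Vv W o₁ oA oB bA bB baseV).s (Adder.zext (u W oB) (f W oB) W) (W + 1)) with hA5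
  have e6 := Yields.eqW_refl hG.adder K (next W o₁) (W + 1) (Γ := Γ ∪ A5)
  set A6 := A5 ∪ ctxSet K (eqW (next W o₁) (next W o₁) (W + 1)) with hA6
  -- e7: link `CV1` with `CLr` on `W+1` positions; `¬ge_{W+1}(CV1)`, lifted to `¬G₁`
  have e7 : G.Yields (Γ ∪ A6) (ctxSet K (linkLines (tD W o₁ oA oB bA bB q baseV).S₁ (mA W o₁ oB bB q).S (W + 3) (W + 1) (W + 1))) ((3 * (W + 1) + 1) * (K.size + 10)) := by
    refine linkLow hG.toRulesOK (tD W o₁ oA oB bA bB q baseV).S₁ (mA W o₁ oB bB q).S (qv.cv1.mono hΓ) (qv.clr.mono hΓ) (by omega) le_rfl (fun i hi => ?_) fun i hi =>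
      Or.inr (Or.inr (mem_ctxSet (mem_eqW hi)))
    show ctx K (eqv (Adder.extOut (Vv W o₁ oA oB bA bB baseV) (W + 2) i) (Adder.zext (u W oB) (f W oB) W i)) ∈ Γ ∪ A6
    rw [Adder.extOut_lt _ (show i < W + 2 by omega)]; exact Or.inr (Or.inl (Or.inr (mem_ctxSet (mem_eqW (a := (Vv W o₁ oA oB bA bB baseV).s) hi))))
  set A7 := A6 ∪ ctxSet K (linkLines (tD W o₁ oA oB bA bB q baseV).S₁ (mA W o₁ oB bB q).S (W + 3) (W + 1) (W + 1)) with hA7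
  have e8 : G.Yields (Γ ∪ A7) {ctx K (neg (var ((tD W o₁ oA oB bA bB q baseV).S₁.ge (W + 3) (W + 1))))} (2 * (K.size + 10)) :=
    DomAux.negTransport hG.toRulesOK (Or.inl hclr) (Or.inr (Or.inr (mem_ctxSet (ge_mem_linkLines _ _ _ _ _))))
  set A8 := A7 ∪ {ctx K (neg (var ((tD W o₁ oA oB bA bB q baseV).S₁.ge (W + 3) (W + 1))))} with hA8
  have e9 : G.Yields (Γ ∪ A8) (ctxSet K (liftList (tD W o₁ oA oB bA bB q baseV).S₁ (W + 3) (W + 1) false 2)) (3 * 2 * (K.size + 9 + 1)) := by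
    refine lift hG (tD W o₁ oA oB bA bB q baseV).S₁ false (qv.cv1.mono hΓ) le_rfl (Or.inr (Or.inr rfl)) (fun j hj hj' => ?_) fun j hj hj' => ?_
    · show ctx K (neg (var (Adder.extOut (Vv W o₁ oA oB bA bB baseV) (W + 2) j))) ∈ Γ ∪ A8
      rcases Nat.lt_succ_iff_lt_or_eq.1 (show j < W + 1 + 1 + 1 by omega) with hj'' | hj''
      · rw [show j = W + 1 by omega, Adder.extOut_lt _ (by omega)]; exact Or.inr (Or.inl (Or.inl (Or.inl (Or.inl (Or.inr (Or.inr rfl))))))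
      · rw [hj'', Adder.extOut_top]; exact Or.inr (Or.inl (Or.inl (Or.inl (Or.inl (Or.inl (Or.inl (mVc _ le_rfl)))))))
    · show ctx K (neg (var (next W o₁ j))) ∈ Γ ∪ A8
      rw [next, zext_ge _ _ (by omega)]; exact Or.inl hfz
  set A9 := A8 ∪ ctxSet K (liftList (tD W o₁ oA oB bA bB q baseV).S₁ (W + 3) (W + 1) false 2) with hA9
  have mG₁ : ctx K (neg (var ((tD W o₁ oA oB bA bB q baseV).S₁.ge (W + 3) (W + 3)))) ∈ Γ ∪ A9 :=
    Or.inr (Or.inr (mem_ctxSet (lit_mem_liftList (tD W o₁ oA oB bA bB q baseV).S₁ (W + 3) (W + 1) false (by norm_num))))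
  -- e10: transitivity `V < n < 2n`
  have e10 : G.Yields (Γ ∪ A9) {χ | χ ∈ (tD W o₁ oA oB bA bB q baseV).lines K} ((W + 3 + 2) * (K.size + 8)) :=
    Yields.of_isBlock (Sub.TransData.isBlock_lines hG.order (tD W o₁ oA oB bA bB q baseV) (qv.cv1.mono hΓ) (qv.cnn.mono hΓ) (qv.cv2.mono hΓ) mG₁ (hΓ hn2n)) subset_rfl
      (Sub.TransData.proofSize_lines _ _)
  set A10 := A9 ∪ {χ | χ ∈ (tD W o₁ oA oB bA bB q baseV).lines K} with hA10
  -- e11: the conclusions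
  have e11 : G.Yields (Γ ∪ A10) ({ctx K (biimp (var ((tD W o₁ oA oB bA bB q baseV).S₁.ge (W + 3) (W + 3))) (disj (var (sel W oA)) (var (sel W oB))))} ∪
      {ctx K (biimp (var ((tD W o₁ oA oB bA bB q baseV).S₃.ge (W + 3) (W + 3))) (conj (var (sel W oA)) (var (sel W oB))))}) ((K.size + 14) + (K.size + 14)) := by
    refine Yields.union ?_ ?_
    · have h := Yields.single (Assoc.infer hG 5 (by decide) (S := Γ ∪ A10)
        (FregeSystem.sub [K, var ((tD W o₁ oA oB bA bB q baseV).S₁.ge (W + 3) (W + 3)), var (sel W oA), var (sel W oB)])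
        (θ := ctx K (biimp (var ((tD W o₁ oA oB bA bB q baseV).S₁.ge (W + 3) (W + 3))) (disj (var (sel W oA)) (var (sel W oB))))) rfl
        (FregeSystem.prems_cons (mG₁.elim Or.inl fun h => Or.inr (Or.inl h))
          (FregeSystem.prems_cons (Or.inl hnselA) (FregeSystem.prems_cons (Or.inl hnselB) FregeSystem.prems_nil))))
      exact h.mono_size (by simp [ctx, size, FregeSystem.size_biimp])
    · have h := Yields.single (Assoc.infer hG 7 (by decide) (S := Γ ∪ A10)
        (FregeSystem.sub [K, var ((tD W o₁ oA oB bA bB q baseV).S₃.ge (W + 3) (W + 3)), var (sel W oA), var (sel W oB)])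
        (θ := ctx K (biimp (var ((tD W o₁ oA oB bA bB q baseV).S₃.ge (W + 3) (W + 3))) (conj (var (sel W oA)) (var (sel W oB))))) rfl
        (FregeSystem.prems_cons (Or.inr (Or.inr ((tD W o₁ oA oB bA bB q baseV).mem_lines K))) (FregeSystem.prems_cons (Or.inl hnselA) FregeSystem.prems_nil)))
      exact h.mono_size (by simp [ctx, size, FregeSystem.size_biimp])
  have h := (((((((((e1.trans e2).trans e3).trans e4).trans e5).trans e6).trans e7).trans e8).trans e9).trans e10).trans e11
  refine (h.mono_right ?_).mono_size (by nlinarith [Nat.zero_le W, Nat.zero_le K.size])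
  rintro θ ⟨L, hL, rfl⟩
  simp only [concl, List.mem_cons, List.not_mem_nil, or_false] at hL
  rcases hL with rfl | rfl
  · exact Or.inr (Or.inl rfl)
  · exact Or.inr (Or.inr rfl)

end Leaves

/-! ### The case analysis -/

section Cases

variable {G : FregeSystem} {K : PropForm ℕ} {Γ : Set (PropForm ℕ)} {W : ℕ} {o₁ oA oB bA bB q : Occ} {baseV : ℕ}

/-- The facts carried into the cases: the three `⊥` literals, no carry of `P_B`, `zext res < n`,
`n < 2n`, and the literal of the outer selector (value `a`). [folklore] -/
def facts (W : ℕ) (o₁ oA oB bA bB q : Occ) (baseV : ℕ) (a : Bool) : List (PropForm ℕ) :=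
  [neg (var (f W o₁)), neg (var (f W oA)), neg (var (f W oB)), neg (var ((P W oB bB).c (W + 1))),
    neg (var ((mA W o₁ oB bB q).S.ge (W + 1) (W + 1))), neg (var ((tD W o₁ oA oB bA bB q baseV).S₂.ge (W + 3) (W + 3))), lit (sel W oA) a]

/-- Sizes of the facts. [folklore] -/
theorem size_of_mem_facts {a : Bool} {L : PropForm ℕ} (h : L ∈ facts W o₁ oA oB bA bB q baseV a) : L.size ≤ 2 := by
  simp only [facts, List.mem_cons, List.not_mem_nil, or_false] at h
  rcases h with rfl | rfl | rfl | rfl | rfl | rfl | rfl <;> (try cases a) <;> simp [lit, size]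

/-- Length of the facts. [folklore] -/
@[simp] theorem length_facts (a : Bool) : (facts W o₁ oA oB bA bB q baseV a).length = 7 := rfl

/-- **The inner case analysis on `G_B`**, under a literal of `G_A` of value `a`: both cases are
handled by the leaves, after weakening the occurrences and the facts into the case contexts.
[cite: CookReckhow1979, §2] [cite: Krajicek1995, §9.2] -/
theorem caseB (hG : ARulesOK G) (a : Bool) (hq : q.Avail (quotAuxT W) (6 * W + 8) K Γ) (hw : QWired W o₁ oA oB bA bB q baseV)
    {mo : Occ} {T : Template} {nIn : ℕ} (hmo : mo.Avail T nIn K Γ)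
    (hmoV : ∀ {K' : PropForm ℕ} {Γ' : Set (PropForm ℕ)}, mo.Avail T nIn K' Γ' → (Vv W o₁ oA oB bA bB baseV).Avail K' Γ' false (W + 2))
    (hbA : bA.Avail (splitAuxT W) (2 * W + 2) K Γ) (hwA : SWired W oA bA) (hbB : bB.Avail (splitAuxT W) (2 * W + 2) K Γ) (hwB : SWired W oB bB)
    (hnA : ∀ i < W, nv W oA i = nv W o₁ i) (hnB : ∀ i < W, nv W oB i = nv W o₁ i) (hF : Holds K Γ (facts W o₁ oA oB bA bB q baseV a)) :
    G.Yields Γ (ctxSet K (concl W o₁ oA oB bA bB q baseV)) ((160 * W + 2 * T.length + 600) * (K.size + 63)) := by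
  have m0 : neg (var (f W o₁)) ∈ facts W o₁ oA oB bA bB q baseV a := by simp [facts]
  have m1 : neg (var (f W oA)) ∈ facts W o₁ oA oB bA bB q baseV a := by simp [facts]
  have m2 : neg (var (f W oB)) ∈ facts W o₁ oA oB bA bB q baseV a := by simp [facts]
  have m3 : neg (var ((P W oB bB).c (W + 1))) ∈ facts W o₁ oA oB bA bB q baseV a := by simp [facts]
  have m4 : neg (var ((mA W o₁ oB bB q).S.ge (W + 1) (W + 1))) ∈ facts W o₁ oA oB bA bB q baseV a := by simp [facts]
  have m5 : neg (var ((tD W o₁ oA oB bA bB q baseV).S₂.ge (W + 3) (W + 3))) ∈ facts W o₁ oA oB bA bB q baseV a := by simp [facts]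
  have m6 : lit (sel W oA) a ∈ facts W o₁ oA oB bA bB q baseV a := by simp [facts]
  -- one case, for a context extension `A` of size `≤ 2` and the corresponding case hypothesis
  have branch : ∀ (A : PropForm ℕ) (b : Bool), A.size ≤ 2 → G.Yields Γ {ctx (disj K A) (lit (sel W oB) b)} (K.size + 5) →
      G.Yields Γ (ctxSet (disj K A) (concl W o₁ oA oB bA bB q baseV)) ((78 * W + T.length + 260) * (K.size + 63)) := by
    intro A b hA hcase
    set K₂ := disj K A with hK₂
    have w1 : G.Yields Γ (ctxSet K₂ ((q.inst (6 * W + 8)).defBodies (quotAuxT W))) ((41 * W + 90) * (K.size + A.size + 59)) := by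
      have h := Inst.DefsAvail.weaken hG.logic hq A; rw [length_quotAuxT] at h; exact h
    have w2 : G.Yields Γ (ctxSet K₂ ((mo.inst nIn).defBodies T)) (T.length * (K.size + A.size + 59)) := Inst.DefsAvail.weaken hG.logic hmo A
    have w3 : G.Yields Γ (ctxSet K₂ ((bA.inst (2 * W + 2)).defBodies (splitAuxT W))) ((3 * W + 3) * (K.size + A.size + 59)) := by
      have h := Inst.DefsAvail.weaken hG.logic hbA A; rw [length_splitAuxT] at h; exact h
    have w4 : G.Yields Γ (ctxSet K₂ ((bB.inst (2 * W + 2)).defBodies (splitAuxT W))) ((3 * W + 3) * (K.size + A.size + 59)) := by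
      have h := Inst.DefsAvail.weaken hG.logic hbB A; rw [length_splitAuxT] at h; exact h
    have w5 : G.Yields Γ (ctxSet K₂ (facts W o₁ oA oB bA bB q baseV a)) (7 * (K.size + A.size + 2 + 2)) := by
      have h := Yields.weaken hG.logic hF A fun L hL => size_of_mem_facts hL
      rw [length_facts] at h; exact h
    have w := ((((w1.union w2).union w3).union w4).union w5).union hcase
    set B : Set (PropForm ℕ) := ((((ctxSet K₂ ((q.inst (6 * W + 8)).defBodies (quotAuxT W)) ∪ ctxSet K₂ ((mo.inst nIn).defBodies T)) ∪
      ctxSet K₂ ((bA.inst (2 * W + 2)).defBodies (splitAuxT W))) ∪ ctxSet K₂ ((bB.inst (2 * W + 2)).defBodies (splitAuxT W))) ∪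
      ctxSet K₂ (facts W o₁ oA oB bA bB q baseV a)) ∪ {ctx K₂ (lit (sel W oB) b)} with hB
    have hq₂ : q.Avail (quotAuxT W) (6 * W + 8) K₂ (Γ ∪ B) :=
      Inst.defsAvail_of_ctxSet_subset fun θ hθ => Or.inr (Or.inl (Or.inl (Or.inl (Or.inl (Or.inl hθ)))))
    have hmo₂ : mo.Avail T nIn K₂ (Γ ∪ B) := Inst.defsAvail_of_ctxSet_subset fun θ hθ => Or.inr (Or.inl (Or.inl (Or.inl (Or.inl (Or.inr hθ)))))
    have hbA₂ : bA.Avail (splitAuxT W) (2 * W + 2) K₂ (Γ ∪ B) := Inst.defsAvail_of_ctxSet_subset fun θ hθ => Or.inr (Or.inl (Or.inl (Or.inl (Or.inr hθ))))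
    have hbB₂ : bB.Avail (splitAuxT W) (2 * W + 2) K₂ (Γ ∪ B) := Inst.defsAvail_of_ctxSet_subset fun θ hθ => Or.inr (Or.inl (Or.inl (Or.inr hθ)))
    have qv := quotAvail hq₂ hw
    have hV := hmoV hmo₂
    have svA := splitAvail hbA₂ hwA
    have svB := splitAvail hbB₂ hwB
    have hFm : ∀ L ∈ facts W o₁ oA oB bA bB q baseV a, ctx K₂ L ∈ Γ ∪ B := fun L hL => Or.inr (Or.inl (Or.inr (mem_ctxSet hL)))
    have hselB : ctx K₂ (lit (sel W oB) b) ∈ Γ ∪ B := Or.inr (Or.inr rfl)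
    have hK₂s : K₂.size = K.size + A.size + 1 := by simp [hK₂, size]
    have c : G.Yields (Γ ∪ B) (ctxSet K₂ (concl W o₁ oA oB bA bB q baseV)) ((30 * W + 120) * (K₂.size + 60)) := by
      cases a <;> cases b
      · exact leafFF hG qv hV svB.adder svA.mask svB.mask (hFm _ m0) (hFm _ m1) (hFm _ m2) (hFm _ m3) (hFm _ m4) (hFm _ m5) (hFm _ m6) hselB
          |>.mono_size (by nlinarith [Nat.zero_le W, Nat.zero_le K₂.size])
      · exact leafFT hG qv hV svB.adder svA.mask svB.mask hnB (hFm _ m0) (hFm _ m1) (hFm _ m2) (hFm _ m4) (hFm _ m6) hselB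
          |>.mono_size (by nlinarith [Nat.zero_le W, Nat.zero_le K₂.size])
      · exact leafTF hG qv hV svB.adder svA.mask svB.mask hnA (hFm _ m0) (hFm _ m1) (hFm _ m2) (hFm _ m3) (hFm _ m4) (hFm _ m6) hselB
          |>.mono_size (by nlinarith [Nat.zero_le W, Nat.zero_le K₂.size])
      · exact leafTT hG qv hV svB.adder svA.mask svB.mask hnA hnB (hFm _ m0) (hFm _ m1) (hFm _ m2) (hFm _ m6) hselB
          |>.mono_size (by nlinarith [Nat.zero_le W, Nat.zero_le K₂.size])
    have h := (w.trans c).mono_right Set.subset_union_right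
    rw [hK₂s] at h
    exact h.mono_size (by nlinarith [Nat.zero_le W, Nat.zero_le K.size, Nat.zero_le T.length, hA])
  -- the two cases and their merge
  have hT := branch (neg (var (sel W oB))) true (by simp [size]) ((Yields.caseHypT hG.logic K (var (sel W oB)) (Γ := Γ)).mono_size (by simp [size]))
  have hF' := branch (var (sel W oB)) false (by simp [size]) ((Yields.caseHypF hG.logic K (var (sel W oB)) (Γ := Γ)).mono_size (by simp [size]))
  have h := Yields.cases hG.logic hT hF' (fun L hL => size_of_mem_concl hL)
  refine h.mono_size ?_
  simp only [concl, List.length_cons, List.length_nil]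
  nlinarith [Nat.zero_le W, Nat.zero_le K.size, Nat.zero_le T.length]

/-- The six facts derived before the case analysis. [folklore] -/
def facts₀ (W : ℕ) (o₁ oA oB bB q : Occ) (bA : Occ) (baseV : ℕ) : List (PropForm ℕ) :=
  [neg (var (f W o₁)), neg (var (f W oA)), neg (var (f W oB)), neg (var ((P W oB bB).c (W + 1))),
    neg (var ((mA W o₁ oB bB q).S.ge (W + 1) (W + 1))), neg (var ((tD W o₁ oA oB bA bB q baseV).S₂.ge (W + 3) (W + 3)))]

/-- The facts of a case are the six facts and the case literal. [folklore] -/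
theorem facts_eq (a : Bool) : facts W o₁ oA oB bA bB q baseV a = facts₀ W o₁ oA oB bB q bA baseV ++ [lit (sel W oA) a] := rfl

/-- **The quotient lines.** For an available, correctly wired quotient occurrence, the occurrence
providing the adder `V`, the split occurrences of `oA` and `oB`, the `⊥` literals, the absence of
carry of `P_B`, the certificate `res < n` and the global certificate `0 < n`:
`[V ≥ n] ↔ (G_A ∨ G_B)` and `[V ≥ 2n] ↔ (G_A ∧ G_B)` are derived, in size polynomial in `W`,
`|K|` and the length of the template of the `V`-occurrence. [cite: CookReckhow1979, §2]
[cite: Krajicek1995, §9.2] -/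
theorem quot (hG : ARulesOK G) (hq : q.Avail (quotAuxT W) (6 * W + 8) K Γ) (hw : QWired W o₁ oA oB bA bB q baseV)
    {mo : Occ} {T : Template} {nIn : ℕ} (hmo : mo.Avail T nIn K Γ)
    (hmoV : ∀ {K' : PropForm ℕ} {Γ' : Set (PropForm ℕ)}, mo.Avail T nIn K' Γ' → (Vv W o₁ oA oB bA bB baseV).Avail K' Γ' false (W + 2))
    (hbA : bA.Avail (splitAuxT W) (2 * W + 2) K Γ) (hwA : SWired W oA bA) (hbB : bB.Avail (splitAuxT W) (2 * W + 2) K Γ) (hwB : SWired W oB bB)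
    (hnA : ∀ i < W, nv W oA i = nv W o₁ i) (hnB : ∀ i < W, nv W oB i = nv W o₁ i)
    (hfz : ctx K (neg (var (f W o₁))) ∈ Γ) (hfA : ctx K (neg (var (f W oA))) ∈ Γ) (hfB : ctx K (neg (var (f W oB))) ∈ Γ)
    (hPc : ctx K (neg (var ((P W oB bB).c (W + 1)))) ∈ Γ) (hres : LtN W K Γ (u W oB) (nv W o₁))
    {zw : ℕ → ℕ} (hz : Holds K Γ (litW zw (fun _ => false) W)) (hzlt : LtN W K Γ zw (nv W o₁)) :
    G.Yields Γ (ctxSet K (concl W o₁ oA oB bA bB q baseV)) ((450 * W + 6 * T.length + 1800) * (K.size + 66)) := by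
  have hΓ : ∀ {X : Set (PropForm ℕ)}, Γ ⊆ Γ ∪ X := fun {X} => Set.subset_union_left
  -- the two certificate consumptions
  have q1 := resLt hG (quotAvail hq hw) hres hfz hfB
  set A1 : Set (PropForm ℕ) := {ctx K (neg (var ((mA W o₁ oB bB q).S.ge (W + 1) (W + 1))))} with hA1
  have q2 := nLt2n hG ((quotAvail hq hw).mono (hΓ (X := A1))) (hz.mono hΓ) (hzlt.mono hΓ) (hΓ hfz)
  set A2 := A1 ∪ {ctx K (neg (var ((tD W o₁ oA oB bA bB q baseV).S₂.ge (W + 3) (W + 3))))} with hA2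
  have hF₀ : Holds K (Γ ∪ A2) (facts₀ W o₁ oA oB bB q bA baseV) := by
    intro L hL
    simp only [facts₀, List.mem_cons, List.not_mem_nil, or_false] at hL
    rcases hL with rfl | rfl | rfl | rfl | rfl | rfl
    exacts [hΓ hfz, hΓ hfA, hΓ hfB, hΓ hPc, Or.inr (Or.inl rfl), Or.inr (Or.inr rfl)]
  have hq' : q.Avail (quotAuxT W) (6 * W + 8) K (Γ ∪ A2) := Inst.DefsAvail.mono hq hΓ
  have hmo' : mo.Avail T nIn K (Γ ∪ A2) := Inst.DefsAvail.mono hmo hΓ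
  have hbA' : bA.Avail (splitAuxT W) (2 * W + 2) K (Γ ∪ A2) := Inst.DefsAvail.mono hbA hΓ
  have hbB' : bB.Avail (splitAuxT W) (2 * W + 2) K (Γ ∪ A2) := Inst.DefsAvail.mono hbB hΓ
  -- one case of the outer analysis
  have branch : ∀ (A : PropForm ℕ) (a : Bool), A.size ≤ 2 → G.Yields (Γ ∪ A2) {ctx (disj K A) (lit (sel W oA) a)} (K.size + 5) →
      G.Yields (Γ ∪ A2) (ctxSet (disj K A) (concl W o₁ oA oB bA bB q baseV)) ((210 * W + 3 * T.length + 820) * (K.size + 66)) := by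
    intro A a hA hcase
    set K₁ := disj K A with hK₁
    have w1 : G.Yields (Γ ∪ A2) (ctxSet K₁ ((q.inst (6 * W + 8)).defBodies (quotAuxT W))) ((41 * W + 90) * (K.size + A.size + 59)) := by
      have h := Inst.DefsAvail.weaken hG.logic hq' A; rw [length_quotAuxT] at h; exact h
    have w2 : G.Yields (Γ ∪ A2) (ctxSet K₁ ((mo.inst nIn).defBodies T)) (T.length * (K.size + A.size + 59)) := Inst.DefsAvail.weaken hG.logic hmo' A
    have w3 : G.Yields (Γ ∪ A2) (ctxSet K₁ ((bA.inst (2 * W + 2)).defBodies (splitAuxT W))) ((3 * W + 3) * (K.size + A.size + 59)) := by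
      have h := Inst.DefsAvail.weaken hG.logic hbA' A; rw [length_splitAuxT] at h; exact h
    have w4 : G.Yields (Γ ∪ A2) (ctxSet K₁ ((bB.inst (2 * W + 2)).defBodies (splitAuxT W))) ((3 * W + 3) * (K.size + A.size + 59)) := by
      have h := Inst.DefsAvail.weaken hG.logic hbB' A; rw [length_splitAuxT] at h; exact h
    have w5 : G.Yields (Γ ∪ A2) (ctxSet K₁ (facts₀ W o₁ oA oB bB q bA baseV)) (6 * (K.size + A.size + 2 + 2)) := by
      have h := Yields.weaken hG.logic hF₀ A (c := 2) fun L hL => size_of_mem_facts (a := a) (by rw [facts_eq]; exact List.mem_append_left _ hL)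
      exact h
    have w := ((((w1.union w2).union w3).union w4).union w5).union hcase
    set B : Set (PropForm ℕ) := ((((ctxSet K₁ ((q.inst (6 * W + 8)).defBodies (quotAuxT W)) ∪ ctxSet K₁ ((mo.inst nIn).defBodies T)) ∪
      ctxSet K₁ ((bA.inst (2 * W + 2)).defBodies (splitAuxT W))) ∪ ctxSet K₁ ((bB.inst (2 * W + 2)).defBodies (splitAuxT W))) ∪
      ctxSet K₁ (facts₀ W o₁ oA oB bB q bA baseV)) ∪ {ctx K₁ (lit (sel W oA) a)} with hB
    have hq₁ : q.Avail (quotAuxT W) (6 * W + 8) K₁ (Γ ∪ A2 ∪ B) :=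
      Inst.defsAvail_of_ctxSet_subset fun θ hθ => Or.inr (Or.inl (Or.inl (Or.inl (Or.inl (Or.inl hθ)))))
    have hmo₁ : mo.Avail T nIn K₁ (Γ ∪ A2 ∪ B) := Inst.defsAvail_of_ctxSet_subset fun θ hθ => Or.inr (Or.inl (Or.inl (Or.inl (Or.inl (Or.inr hθ)))))
    have hbA₁ : bA.Avail (splitAuxT W) (2 * W + 2) K₁ (Γ ∪ A2 ∪ B) :=
      Inst.defsAvail_of_ctxSet_subset fun θ hθ => Or.inr (Or.inl (Or.inl (Or.inl (Or.inr hθ))))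
    have hbB₁ : bB.Avail (splitAuxT W) (2 * W + 2) K₁ (Γ ∪ A2 ∪ B) := Inst.defsAvail_of_ctxSet_subset fun θ hθ => Or.inr (Or.inl (Or.inl (Or.inr hθ)))
    have hF₁ : Holds K₁ (Γ ∪ A2 ∪ B) (facts W o₁ oA oB bA bB q baseV a) := by
      intro L hL
      rw [facts_eq] at hL
      rcases List.mem_append.1 hL with hL | hL
      · exact Or.inr (Or.inl (Or.inr (mem_ctxSet hL)))
      · rw [List.mem_singleton.1 hL]; exact Or.inr (Or.inr rfl)
    have hK₁s : K₁.size = K.size + A.size + 1 := by simp [hK₁, size]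
    have c := caseB hG a hq₁ hw hmo₁ (fun h => hmoV h) hbA₁ hwA hbB₁ hwB hnA hnB hF₁
    have h := (w.trans c).mono_right Set.subset_union_right
    rw [hK₁s] at h
    exact h.mono_size (by nlinarith [Nat.zero_le W, Nat.zero_le K.size, Nat.zero_le T.length, hA])
  have hT := branch (neg (var (sel W oA))) true (by simp [size])
    ((Yields.caseHypT hG.logic K (var (sel W oA)) (Γ := Γ ∪ A2)).mono_size (by simp [size]))
  have hF' := branch (var (sel W oA)) false (by simp [size])
    ((Yields.caseHypF hG.logic K (var (sel W oA)) (Γ := Γ ∪ A2)).mono_size (by simp [size]))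
  have hc := Yields.cases hG.logic hT hF' (fun L hL => size_of_mem_concl hL)
  have h := (q1.trans q2).trans hc
  refine (h.mono_right Set.subset_union_right).mono_size ?_
  simp only [concl, List.length_cons, List.length_nil]
  nlinarith [Nat.zero_le W, Nat.zero_le K.size, Nat.zero_le T.length]

end Cases

end AssocQuot

end ModAdd

end Literature.Computability.MetaComplexity
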